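import Literature.InformationTheory.QuantumCodes.LocalCodeEnergyBarrierPeriodic
import Literature.InformationTheory.QuantumCodes.LocalCodeLogicalOperatorTradeoff
import Literature.InformationTheory.QuantumCodes.SubsystemCodeTradeoff
import HarnessLib

/-!
# Haah–Preskill 2012, Theorem 4 (no partial self-correction in 2D), stabilizer codes on the torus — proof

J. Haah, J. Preskill, arXiv:1011.3529 [HaahPreskill2012], §6 (chunk p0013 L1–41): the Hamiltonian `H = −Σ_a S_a`
(Eq. (Hamiltonian)), Pauli walks, «the barrier height `Δ(x)` … we say that the quantum memory is partially self
correcting if `Δ_max` grows faster than logarithmically with `L`». «Theorem 4. (Limitation on partial self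
correction in local subsystem codes) For a two-dimensional local subsystem code, with qubits residing at sites of an
`L × L` square lattice, suppose that `{S_a}` is a (possibly overcomplete) set of geometrically local stabilizer
generators, where the number of generators acting on each qubit is an `L`-independent constant. Consider a quantum
memory governed by the Hamiltonian eq. (Hamiltonian). If the code distance is `d = Ω(L)`, then the memory is not
partially self correcting — i.e., `Δ_max = O(1)`. More generally, if the code distance is `d = Ω(L^α)` in `D` spatial
dimensions, then `Δ_max = O(L^β)`, where `β = D−1−α/(D−1)`.» Proof (p0014 L1–12): «the proof of Theorem 1 shows that
the support of any dressed logical operator can be reduced to a network of overlapping `(D−1)`-dimensional slabs …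
there are `O(L/l)` slabs … Arguing as in [BT09] …».

THIS FILE PROVES the theorem on the `L × L` TORUS, for EVERY (dressed) logical class, with an explicit polynomial
bound, in the printed generality (subsystem codes whose gauge AND stabilizer generators are local, Hamiltonian = the
local stabilizer generators): `HaahPreskill2012_theorem4_torus (w gmax) : ∃ c > 0, ∀ L n k d e G γ g, G = ⟨γ⟩ →
(γ_b in periodic w × w windows) → S̄ = G ∩ G⊥ = ⟨g⟩ → (g_a in periodic w × w windows) → (≤ g_max terms per qubit) →
IsSubsystemCode G k d → 1 ≤ d → ∀ x ∈ S̄⊥, ∃ x' ∈ S̄⊥, x' − x ∈ G ∧ ∃ walk 0 = P_0,…,P_m = x' with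
ε(P_i) ≤ c · (L/d + 1)² for all i`, and its stabilizer special case `HaahPreskill2012_theorem4_stabilizer_torus`
(`G = S̄`, `IsAdditiveCode`, `x' − x ∈ S̄`). In particular `d ≥ δL ⇒ Δ_max ≤ c(1/δ + 1)²`, independent of `L` — the
theorem's main clause; and, with the sharper per-period charging of the last section (`front₁`: corridor columns of
the periods adjacent to the threshold only), the printed exponent: `HaahPreskill2012_theorem4_torus_linear` /
`HaahPreskill2012_theorem4_stabilizer_torus_linear` give `ε(P_i) ≤ c · (L/d + 1)`, i.e. `Δ_max = O(L^{1−α})` for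
`d = Ω(L^α)` (`β = D − 1 − α/(D−1)` at `D = 2`).
-- TODO(general form): `D ≥ 3`; open boundary conditions.

Proof (as printed, quantitative): by `LocalCodeLogicalOperatorTradeoff.lean` (HP Thm. 1) every logical class has a
representative `E'` on the corridor network `Y` of the BPT partition with `Q = O(L/d)` periods («network of
overlapping slabs»); implement `E'` period by period — inside a block column first its vertical corridor strip row
by row, then its horizontal corridor pieces column by column (`pscKey`); a generator anticommuting with a partial
operator sees an applied and an unapplied qubit of `Y` in one `w × w` window, and the four corridor/non-corridor
cases put one of them into a region of `O(w²Q²)` qubits (`front`, `card_front_le`, `mem_front_of_straddle`): corridor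
column × (bad row ∪ first rows ∪ rows at the strip front), or corridor row × columns at the piece front — so
`ε ≤ 2 g_max · O(w² Q²)` («Arguing as in [BT09]»: only fronts and strip crossings cost energy). Degenerate regimes
(`Y` = everything: plain row sweep of `LocalCodeEnergyBarrierPeriodic.lean`, `ε ≤ 4 w g_max L` with `L ≤ c/d`-type
bounds) are folded into the constant.

## Mathlib / tree search

Tree: `BPTTorus.{per, IsCorr, Bad, Close, badFin, card_badFin_le, IsCorr.bad, per_eq_of_close_of_isCorr,
per_eq_of_close_of_not_isCorr, bad_of_close_of_isCorr, close_of_inCubePeriodic, exists_correctable_cube, cube,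
card_cube_eq}` (LocalCodeTradeoffTorus.lean); `HPTradeoff.{InCorridor, isCorrectableRegion_blocks,
card_filter_inCorridor_le}` (LocalCodeLogicalOperatorTradeoff.lean); `EnergyBarrier.{prefixWalk, prefixWalk_zero,
prefixWalk_of_forall_lt, sympWeight_prefixWalk_step, exists_crossing_of_sympInner_prefixWalk_ne_zero, rowIndex,
energyCost_prefixWalk_le_periodic}`, `energyCost`, `IsPauliWalk` (LocalCodeEnergyBarrier(Periodic).lean);
`sup_sympDual_inf_supportedOn_compl_eq` (QuantumSingletonBound.lean); `SubsystemTorus.{exists_gaugeCorrectable_cube,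
bareFree_blocks}` (SubsystemCodeTradeoff.lean); `gaugeStabilizer`, `IsSubsystemCode`, `IsGaugeCorrectable`,
`sup_gauge_dressed_compl_eq`, `isSelfOrthogonal_gaugeStabilizer` (SubsystemCodes.lean).
-/

namespace Literature.InformationTheory.QuantumCodes

open Finset Module
open Classical

variable {n : ℕ}

namespace PartialSelfCorrection

open BPTTorus HPTradeoff EnergyBarrier

section Walk

variable {L : ℕ} (e : Fin n ≃ (Fin 2 → Fin L)) (Q t : ℕ)

/-- **The sweep order**: period of the column first; inside a block column, the corridor columns (the vertical
strip) row by row, then the other columns (horizontal corridor pieces) column by column. Column: definition.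
[cite: HaahPreskill2012, §6 proof of Thm. 4 (p. 14: «the support … reduced to a network of overlapping slabs … Arguing as in [BT09]»)] -/
noncomputable def pscKey (q : Fin n) : ℕ :=
  per L Q (e q 0 : ℕ) * (2 * L ^ 2) +
    (if IsCorr L Q t (e q 0 : ℕ) then (e q 1 : ℕ) * L + (e q 0 : ℕ) else L ^ 2 + ((e q 0 : ℕ) * L + (e q 1 : ℕ)))

/-- The charging region of a threshold `i`: corridor columns × (bad rows ∪ the first `t+1` rows ∪ the `t+1` rows at
the strip front), and (the `t+1` columns at the piece front) × corridor rows. Column: definition.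
[cite: HaahPreskill2012, §6 proof of Thm. 4 with BravyiTerhal2009 §2 proof of Thm. 2 («only from the two end-points of the string»)] -/
noncomputable def front (i : ℕ) : Finset (Fin n) :=
  univ.filter fun q =>
    (IsCorr L Q t (e q 0 : ℕ) ∧ (Bad L Q t (e q 1 : ℕ) ∨ (e q 1 : ℕ) < t + 1 ∨
        ((e q 1 : ℕ) ≤ i % (2 * L ^ 2) / L ∧ i % (2 * L ^ 2) / L ≤ (e q 1 : ℕ) + t))) ∨
      (IsCorr L Q t (e q 1 : ℕ) ∧ (e q 0 : ℕ) ≤ (i % (2 * L ^ 2) - L ^ 2) / L ∧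
        (i % (2 * L ^ 2) - L ^ 2) / L ≤ (e q 0 : ℕ) + t)

variable {e Q t}

/-- The in-block part of the key is `< 2L²`. [folklore] -/
private theorem rest_lt (q : Fin n) :
    (if IsCorr L Q t (e q 0 : ℕ) then (e q 1 : ℕ) * L + (e q 0 : ℕ) else L ^ 2 + ((e q 0 : ℕ) * L + (e q 1 : ℕ)))
      < 2 * L ^ 2 := by
  have hx := (e q 0).isLt
  have hy := (e q 1).isLt
  have h1 : (e q 1 : ℕ) * L + (e q 0 : ℕ) < L ^ 2 := by nlinarith
  have h2 : (e q 0 : ℕ) * L + (e q 1 : ℕ) < L ^ 2 := by nlinarith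
  split_ifs <;> omega

/-- Period and in-block part are recovered from the key. [folklore] -/
private theorem key_div_mod (hL : 0 < L) (q : Fin n) :
    pscKey e Q t q / (2 * L ^ 2) = per L Q (e q 0 : ℕ) ∧
      pscKey e Q t q % (2 * L ^ 2) =
        (if IsCorr L Q t (e q 0 : ℕ) then (e q 1 : ℕ) * L + (e q 0 : ℕ)
          else L ^ 2 + ((e q 0 : ℕ) * L + (e q 1 : ℕ))) := by
  have hr := rest_lt (e := e) (Q := Q) (t := t) q
  have hL2 : 0 < 2 * L ^ 2 := by positivity
  unfold pscKey
  constructor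
  · rw [Nat.add_comm, Nat.add_mul_div_right _ _ hL2, Nat.div_eq_of_lt hr, zero_add]
  · rw [Nat.add_comm, Nat.add_mul_mod_self_right, Nat.mod_eq_of_lt hr]

/-- The sweep order is injective. [folklore] -/
private theorem pscKey_injective (hL : 0 < L) : Function.Injective (pscKey e Q t) := by
  intro q q' h
  have h1 := key_div_mod (e := e) (Q := Q) (t := t) hL q
  have h2 := key_div_mod (e := e) (Q := Q) (t := t) hL q'
  rw [h] at h1
  have hrest := h1.2.symm.trans h2.2
  have hx := (e q 0).isLt
  have hy := (e q 1).isLt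
  have hx' := (e q' 0).isLt
  have hy' := (e q' 1).isLt
  have hsq : L ^ 2 = L * L := sq L
  have key : (e q 0 : ℕ) = (e q' 0 : ℕ) ∧ (e q 1 : ℕ) = (e q' 1 : ℕ) := by
    by_cases hc : IsCorr L Q t (e q 0 : ℕ) <;> by_cases hc' : IsCorr L Q t (e q' 0 : ℕ) <;>
      simp only [hc, hc', if_true, if_false] at hrest
    · have hd : ((e q 1 : ℕ) * L + (e q 0 : ℕ)) / L = ((e q' 1 : ℕ) * L + (e q' 0 : ℕ)) / L := by rw [hrest]
      have hm : ((e q 1 : ℕ) * L + (e q 0 : ℕ)) % L = ((e q' 1 : ℕ) * L + (e q' 0 : ℕ)) % L := by rw [hrest]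
      rw [Nat.add_comm, Nat.add_mul_div_right _ _ hL, Nat.div_eq_of_lt hx, zero_add,
        Nat.add_comm ((e q' 1 : ℕ) * L), Nat.add_mul_div_right _ _ hL, Nat.div_eq_of_lt hx', zero_add] at hd
      rw [Nat.add_comm, Nat.add_mul_mod_self_right, Nat.mod_eq_of_lt hx,
        Nat.add_comm ((e q' 1 : ℕ) * L), Nat.add_mul_mod_self_right, Nat.mod_eq_of_lt hx'] at hm
      exact ⟨hm, hd⟩
    · exfalso
      have : (e q 1 : ℕ) * L + (e q 0 : ℕ) < L ^ 2 := by nlinarith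
      omega
    · exfalso
      have : (e q' 1 : ℕ) * L + (e q' 0 : ℕ) < L ^ 2 := by nlinarith
      omega
    · have hrest' : (e q 0 : ℕ) * L + (e q 1 : ℕ) = (e q' 0 : ℕ) * L + (e q' 1 : ℕ) := by omega
      have hd : ((e q 0 : ℕ) * L + (e q 1 : ℕ)) / L = ((e q' 0 : ℕ) * L + (e q' 1 : ℕ)) / L := by rw [hrest']
      have hm : ((e q 0 : ℕ) * L + (e q 1 : ℕ)) % L = ((e q' 0 : ℕ) * L + (e q' 1 : ℕ)) % L := by rw [hrest']
      rw [Nat.add_comm, Nat.add_mul_div_right _ _ hL, Nat.div_eq_of_lt hy, zero_add,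
        Nat.add_comm ((e q' 0 : ℕ) * L), Nat.add_mul_div_right _ _ hL, Nat.div_eq_of_lt hy', zero_add] at hd
      rw [Nat.add_comm, Nat.add_mul_mod_self_right, Nat.mod_eq_of_lt hy,
        Nat.add_comm ((e q' 0 : ℕ) * L), Nat.add_mul_mod_self_right, Nat.mod_eq_of_lt hy'] at hm
      exact ⟨hd, hm⟩
  apply e.injective
  funext j
  fin_cases j
  · exact Fin.ext key.1
  · exact Fin.ext key.2

/-- **The straddling lemma.** If an applied qubit `u` (key `< i`) and an unapplied qubit `v` (key `≥ i`) of the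
corridor network lie in one periodic window of range `t + 1`, then `u` or `v` lies in the charging region of `i`:
(corridor, corridor) columns ⇒ same period and both in the vertical strip, so `u` is at the strip front or in the first
rows; (corridor, block) ⇒ `v` sits on a corridor row and `u`'s row is bad; (block, corridor) ⇒ symmetric;
(block, block) ⇒ same period, both on corridor rows, `u` at the piece front.
[cite: HaahPreskill2012, §6 proof of Thm. 4 («Arguing as in [BT09]»); BravyiTerhal2009, §2 proof of Thm. 2] -/
theorem mem_front_of_straddle (hQ : 0 < Q) (hL : 0 < L) (h2 : 2 * t * Q ≤ L) {c : Fin 2 → Fin L} {u v : Fin n}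
    (hu : InCubePeriodic (t + 1) c (e u)) (hv : InCubePeriodic (t + 1) c (e v))
    (huY : InCorridor e Q t u) (hvY : InCorridor e Q t v) {i : ℕ} (hui : pscKey e Q t u < i)
    (hvi : i ≤ pscKey e Q t v) : u ∈ front e Q t i ∨ v ∈ front e Q t i := by
  have hcx := close_of_inCubePeriodic (e := e) hu hv 0
  have hcy := close_of_inCubePeriodic (e := e) hu hv 1
  have hxu := (e u 0).isLt
  have hxv := (e v 0).isLt
  have hyu := (e u 1).isLt
  have hyv := (e v 1).isLt
  have hL2 : 0 < 2 * L ^ 2 := by positivity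
  have hsq : L ^ 2 = L * L := sq L
  -- InCorridor in two coordinates
  have hY : ∀ {q : Fin n}, InCorridor e Q t q ↔ IsCorr L Q t (e q 0 : ℕ) ∨ IsCorr L Q t (e q 1 : ℕ) := by
    intro q
    constructor
    · rintro ⟨j, hj⟩
      fin_cases j
      · exact Or.inl hj
      · exact Or.inr hj
    · rintro (h | h)
      · exact ⟨0, h⟩
      · exact ⟨1, h⟩
  have hku := key_div_mod (e := e) (Q := Q) (t := t) hL u
  have hkv := key_div_mod (e := e) (Q := Q) (t := t) hL v
  by_cases hcu : IsCorr L Q t (e u 0 : ℕ) <;> by_cases hcv : IsCorr L Q t (e v 0 : ℕ)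
  · -- (corridor, corridor): same period; u at the strip front or near row 0
    left
    have hper := per_eq_of_close_of_isCorr hQ hL h2 hxu hxv hcu hcv hcx
    rw [if_pos hcu] at hku
    rw [if_pos hcv] at hkv
    -- same period ⇒ compare the in-block parts with ρ = i % (2L²)
    have hP : pscKey e Q t u / (2 * L ^ 2) = pscKey e Q t v / (2 * L ^ 2) := by rw [hku.1, hkv.1, hper]
    have hdm_u := Nat.div_add_mod (pscKey e Q t u) (2 * L ^ 2)
    have hdm_v := Nat.div_add_mod (pscKey e Q t v) (2 * L ^ 2)
    have hdm_i := Nat.div_add_mod i (2 * L ^ 2)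
    have hi1 : i / (2 * L ^ 2) = pscKey e Q t u / (2 * L ^ 2) := by
      apply le_antisymm
      · rw [hP]; exact Nat.div_le_div_right hvi
      · exact Nat.div_le_div_right hui.le
    have hru : (e u 1 : ℕ) * L + (e u 0 : ℕ) < i % (2 * L ^ 2) := by
      have := hku.2; rw [hi1] at hdm_i; omega
    have hrv : i % (2 * L ^ 2) ≤ (e v 1 : ℕ) * L + (e v 0 : ℕ) := by
      have := hkv.2; rw [hi1, hP] at hdm_i; omega
    -- rows: y_u ≤ y₀ ≤ y_v with y₀ = (i % 2L²) / L
    have hy0u : (e u 1 : ℕ) ≤ i % (2 * L ^ 2) / L := by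
      rw [Nat.le_div_iff_mul_le hL]; nlinarith
    have hy0v : i % (2 * L ^ 2) / L ≤ (e v 1 : ℕ) := by
      have : i % (2 * L ^ 2) < ((e v 1 : ℕ) + 1) * L := by nlinarith
      have := (Nat.div_lt_iff_lt_mul hL).2 this
      omega
    rw [front, mem_filter]
    refine ⟨mem_univ _, Or.inl ⟨hcu, ?_⟩⟩
    unfold Close at hcy
    omega
  · -- (corridor, block): v lies on a corridor row, u's row is bad
    left
    have hvrow : IsCorr L Q t (e v 1 : ℕ) := ((hY).1 hvY).resolve_left hcv
    have hbad : Bad L Q t (e u 1 : ℕ) := by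
      have hcy' : Close L t (e v 1 : ℕ) (e u 1 : ℕ) := by unfold Close at hcy ⊢; omega
      exact bad_of_close_of_isCorr hQ hL h2 hyv hyu hvrow hcy'
    rw [front, mem_filter]
    exact ⟨mem_univ _, Or.inl ⟨hcu, Or.inl hbad⟩⟩
  · -- (block, corridor): symmetric, charge v
    right
    have hurow : IsCorr L Q t (e u 1 : ℕ) := ((hY).1 huY).resolve_left hcu
    have hbad : Bad L Q t (e v 1 : ℕ) := bad_of_close_of_isCorr hQ hL h2 hyu hyv hurow hcy
    rw [front, mem_filter]
    exact ⟨mem_univ _, Or.inl ⟨hcv, Or.inl hbad⟩⟩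
  · -- (block, block): same period, both on corridor rows; u at the piece front
    left
    have hurow : IsCorr L Q t (e u 1 : ℕ) := ((hY).1 huY).resolve_left hcu
    have hper := per_eq_of_close_of_not_isCorr hcu hcv hcx
    rw [if_neg hcu] at hku
    rw [if_neg hcv] at hkv
    have hP : pscKey e Q t u / (2 * L ^ 2) = pscKey e Q t v / (2 * L ^ 2) := by rw [hku.1, hkv.1, hper]
    have hdm_u := Nat.div_add_mod (pscKey e Q t u) (2 * L ^ 2)
    have hdm_v := Nat.div_add_mod (pscKey e Q t v) (2 * L ^ 2)
    have hdm_i := Nat.div_add_mod i (2 * L ^ 2)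
    have hi1 : i / (2 * L ^ 2) = pscKey e Q t u / (2 * L ^ 2) := by
      apply le_antisymm
      · rw [hP]; exact Nat.div_le_div_right hvi
      · exact Nat.div_le_div_right hui.le
    have hru : L ^ 2 + ((e u 0 : ℕ) * L + (e u 1 : ℕ)) < i % (2 * L ^ 2) := by
      have := hku.2; rw [hi1] at hdm_i; omega
    have hrv : i % (2 * L ^ 2) ≤ L ^ 2 + ((e v 0 : ℕ) * L + (e v 1 : ℕ)) := by
      have := hkv.2; rw [hi1, hP] at hdm_i; omega
    -- columns: x_u ≤ x₀ ≤ x_v with x₀ = (i % 2L² − L²) / L; no wrap (the last t columns are corridor columns)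
    have hx0u : (e u 0 : ℕ) ≤ (i % (2 * L ^ 2) - L ^ 2) / L := by
      rw [Nat.le_div_iff_mul_le hL]
      have : (e u 0 : ℕ) * L + (e u 1 : ℕ) < i % (2 * L ^ 2) - L ^ 2 := by omega
      nlinarith
    have hx0v : (i % (2 * L ^ 2) - L ^ 2) / L ≤ (e v 0 : ℕ) := by
      have h1 : i % (2 * L ^ 2) - L ^ 2 ≤ (e v 0 : ℕ) * L + (e v 1 : ℕ) := by omega
      have h2 : i % (2 * L ^ 2) - L ^ 2 < ((e v 0 : ℕ) + 1) * L := by rw [add_one_mul]; omega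
      have := (Nat.div_lt_iff_lt_mul hL).2 h2
      omega
    have hnw1 : ¬ (L ≤ (e v 0 : ℕ) + t) := fun h => hcv (Or.inl h)
    have hnw2 : ¬ (L ≤ (e u 0 : ℕ) + t) := fun h => hcu (Or.inl h)
    rw [front, mem_filter]
    refine ⟨mem_univ _, Or.inr ⟨hurow, hx0u, ?_⟩⟩
    unfold Close at hcx
    omega

/-- **Size of the charging region**: `≤ 3tQ·(3tQ + 2t + 2) + 3tQ·(t + 1)` (corridor and bad columns/rows number at
most `3tQ` each). [cite: HaahPreskill2012, §6 proof of Thm. 4 («there are O(L/l) slabs»)] -/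
theorem card_front_le (hQ : 0 < Q) (hL : 0 < L) (h2 : 2 * t * Q ≤ L) (i : ℕ) :
    #(front e Q t i) ≤ 3 * t * Q * (3 * t * Q + (t + 1) + (t + 1)) + 3 * t * Q * (t + 1) := by
  haveI : NeZero L := ⟨hL.ne'⟩
  set corr : Finset (Fin L) := univ.filter fun s : Fin L => IsCorr L Q t (s : ℕ) with hcorr
  have hcorr_le : #corr ≤ 3 * t * Q := by
    refine le_trans (card_le_card fun s hs => ?_) (card_badFin_le (L := L) (t := t) hQ hL h2)
    rw [hcorr, mem_filter] at hs
    unfold badFin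
    exact mem_filter.2 ⟨mem_univ _, hs.2.bad⟩
  have hbad_le := card_badFin_le (L := L) (t := t) hQ hL h2
  set y₀ := i % (2 * L ^ 2) / L
  set x₀ := (i % (2 * L ^ 2) - L ^ 2) / L
  set rows : Finset (Fin L) := badFin L Q t ∪ univ.filter (fun s : Fin L => (s : ℕ) < t + 1) ∪
    univ.filter (fun s : Fin L => (s : ℕ) ≤ y₀ ∧ y₀ ≤ (s : ℕ) + t) with hrows
  set cols : Finset (Fin L) := univ.filter (fun s : Fin L => (s : ℕ) ≤ x₀ ∧ x₀ ≤ (s : ℕ) + t) with hcols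
  have hIcc : ∀ (a : ℕ), #(univ.filter fun s : Fin L => (s : ℕ) ≤ a ∧ a ≤ (s : ℕ) + t) ≤ t + 1 := by
    intro a
    calc #(univ.filter fun s : Fin L => (s : ℕ) ≤ a ∧ a ≤ (s : ℕ) + t)
        ≤ #(Finset.Icc (a - t) a) := by
          refine card_le_card_of_injOn (fun s : Fin L => (s : ℕ)) (fun s hs => ?_) (fun a _ b _ h => Fin.ext h)
          have hs' := (mem_filter.1 (mem_coe.1 hs)).2
          simp only [coe_Icc, Set.mem_Icc]; omega
      _ ≤ t + 1 := by rw [Nat.card_Icc]; omega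
  have hlow : #(univ.filter fun s : Fin L => (s : ℕ) < t + 1) ≤ t + 1 := by
    calc #(univ.filter fun s : Fin L => (s : ℕ) < t + 1) ≤ #(Finset.range (t + 1)) := by
          refine card_le_card_of_injOn (fun s : Fin L => (s : ℕ)) (fun s hs => ?_) (fun a _ b _ h => Fin.ext h)
          have hs' := (mem_filter.1 (mem_coe.1 hs)).2
          simpa using hs'
      _ = t + 1 := card_range _
  have hrows_le : #rows ≤ 3 * t * Q + (t + 1) + (t + 1) := by
    rw [hrows]
    refine (card_union_le _ _).trans (Nat.add_le_add ((card_union_le _ _).trans (Nat.add_le_add hbad_le hlow)) ?_)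
    exact hIcc _
  have hcols_le : #cols ≤ t + 1 := hIcc _
  calc #(front e Q t i) ≤ #((corr ×ˢ rows ∪ cols ×ˢ corr).map
        ⟨fun p : Fin L × Fin L => p, fun a b h => h⟩) := by
        rw [card_map]
        refine card_le_card_of_injOn (fun q => (e q 0, e q 1)) (fun q hq => ?_) ?_
        · have hq' := (mem_filter.1 (mem_coe.1 hq)).2
          rw [coe_union, Set.mem_union, coe_product, coe_product, Set.mem_prod, Set.mem_prod]
          simp only [mem_coe, hcorr, hrows, hcols, mem_union, mem_filter, mem_univ, true_and]
          unfold badFin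
          rw [mem_filter]
          rcases hq' with ⟨hc, h⟩ | ⟨hc, h1, h2⟩
          · refine Or.inl ⟨hc, ?_⟩
            rcases h with h | h | h
            · exact Or.inl (Or.inl ⟨mem_univ _, h⟩)
            · exact Or.inl (Or.inr h)
            · exact Or.inr h
          · exact Or.inr ⟨⟨h1, h2⟩, hc⟩
        · intro q _ q' _ h
          simp only [Prod.mk.injEq] at h
          apply e.injective
          funext j
          fin_cases j
          · exact h.1
          · exact h.2
    _ ≤ #(corr ×ˢ rows) + #(cols ×ˢ corr) := by rw [card_map]; exact card_union_le _ _
    _ ≤ 3 * t * Q * (3 * t * Q + (t + 1) + (t + 1)) + (t + 1) * (3 * t * Q) := by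
        rw [card_product, card_product]
        exact Nat.add_le_add (Nat.mul_le_mul hcorr_le hrows_le) (Nat.mul_le_mul hcols_le hcorr_le)
    _ = 3 * t * Q * (3 * t * Q + (t + 1) + (t + 1)) + 3 * t * Q * (t + 1) := by ring

/-- **Energy along the network sweep.** For `E` commuting with every generator and supported on the corridor network,
generators of periodic range `t + 1`, at most `g_max` per qubit: every prefix of the sweep has energy cost
`≤ 2 g_max · |front|`. [cite: HaahPreskill2012, §6 proof of Thm. 4; BravyiTerhal2009, §2 proof of Thm. 2] -/
theorem energyCost_sweep_le {ι : Type*} [Fintype ι] {g : ι → SympVec n} {gmax : ℕ} (hQ : 0 < Q) (hL : 0 < L)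
    (h2 : 2 * t * Q ≤ L) (hg : ∀ a, IsCubeLocalPeriodic e (t + 1) (g a))
    (hdeg : ∀ q : Fin n, #(univ.filter fun a => q ∈ sympSupport (g a)) ≤ gmax) {E : SympVec n}
    (hE : ∀ a, sympInner (g a) E = 0) (hEs : E ∈ supportedOn (univ.filter fun q => InCorridor e Q t q)) (i : ℕ) :
    energyCost g (prefixWalk (pscKey e Q t) E i) ≤
      2 * gmax * (3 * t * Q * (3 * t * Q + (t + 1) + (t + 1)) + 3 * t * Q * (t + 1)) := by
  unfold energyCost
  set R := front e Q t i
  have hsub : (univ.filter fun a => sympInner (g a) (prefixWalk (pscKey e Q t) E i) ≠ 0) ⊆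
      R.biUnion (fun q => univ.filter fun a => q ∈ sympSupport (g a)) := by
    intro a ha
    simp only [mem_filter, mem_univ, true_and] at ha
    obtain ⟨⟨u, hua, huE, hui⟩, ⟨v, hva, hvE, hvi⟩⟩ :=
      exists_crossing_of_sympInner_prefixWalk_ne_zero (hE a) ha
    obtain ⟨c, hc⟩ := hg a
    have hY : ∀ {q : Fin n}, q ∈ sympSupport E → InCorridor e Q t q := by
      intro q hq
      by_contra hne
      have h0 := hEs q (by simpa using hne)
      simp only [sympSupport, mem_filter, mem_univ, true_and] at hq
      rcases hq with h | h
      · exact h h0.1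
      · exact h h0.2
    rw [mem_biUnion]
    rcases mem_front_of_straddle hQ hL h2 (hc u hua) (hc v hva) (hY huE) (hY hvE) hui hvi with h | h
    · exact ⟨u, h, by simpa using hua⟩
    · exact ⟨v, h, by simpa using hva⟩
  calc 2 * #(univ.filter fun a => sympInner (g a) (prefixWalk (pscKey e Q t) E i) ≠ 0)
      ≤ 2 * #(R.biUnion fun q => univ.filter fun a => q ∈ sympSupport (g a)) :=
        Nat.mul_le_mul_left _ (card_le_card hsub)
    _ ≤ 2 * ∑ q ∈ R, #(univ.filter fun a => q ∈ sympSupport (g a)) :=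
        Nat.mul_le_mul_left _ card_biUnion_le
    _ ≤ 2 * ∑ _q ∈ R, gmax := Nat.mul_le_mul_left _ (sum_le_sum fun q _ => hdeg q)
    _ = 2 * (#R * gmax) := by rw [sum_const, smul_eq_mul]
    _ ≤ 2 * ((3 * t * Q * (3 * t * Q + (t + 1) + (t + 1)) + 3 * t * Q * (t + 1)) * gmax) := by
        gcongr; exact card_front_le hQ hL h2 i
    _ = 2 * gmax * (3 * t * Q * (3 * t * Q + (t + 1) + (t + 1)) + 3 * t * Q * (t + 1)) := by ring

end Walk

/-! ### Assembly -/

section Assembly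

variable {L : ℕ} {e : Fin n ≃ (Fin 2 → Fin L)} {Q t : ℕ} {ι : Type*} [Fintype ι] {g : ι → SympVec n}
  {S : Submodule (ZMod 2) (SympVec n)}

/-- Keys are below `Q · 2L²`. [folklore] -/
private theorem pscKey_lt (hQ : 0 < Q) (hL : 0 < L) (q : Fin n) : pscKey e Q t q < Q * (2 * L ^ 2) := by
  have hr := rest_lt (e := e) (Q := Q) (t := t) q
  have hper : per L Q (e q 0 : ℕ) < Q := by
    unfold per
    rw [Nat.div_lt_iff_lt_mul hL, Nat.mul_comm Q L]
    exact Nat.mul_lt_mul_of_pos_right (e q 0).isLt hQ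
  unfold pscKey
  have : (per L Q (e q 0 : ℕ) + 1) * (2 * L ^ 2) ≤ Q * (2 * L ^ 2) := Nat.mul_le_mul_right _ hper
  split_ifs at hr ⊢ <;> nlinarith

/-- The energy cost of the identity is `0`. [folklore] -/
private theorem energyCost_zero' : energyCost g (0 : SympVec n) = 0 := by
  unfold energyCost
  rw [Finset.card_eq_zero.2, mul_zero]
  refine filter_eq_empty_iff.2 fun a _ h => h ?_
  rw [sympInner_comm]; exact sympInner_zero_left _

/-- **The network walk for a representative on the corridor set.** With `Q` periods (`2tQ ≤ L ≤ Q(R+t)`), every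
side-`R` square correctable and generators of range `t + 1`: every `E ∈ S̄⊥` has a representative `E' ≡ E (mod S̄)`
on the corridor network, implemented by the sweep with energy `≤ 2 g_max |front|` throughout.
[cite: HaahPreskill2012, §6 proof of Thm. 4 (p. 14) with §4 proof of Thm. 1] -/
theorem exists_rep_walk_network (hS : S = Submodule.span (ZMod 2) (Set.range g)) (hself : IsSelfOrthogonal S)
    (hg : ∀ a, IsCubeLocalPeriodic e (t + 1) (g a)) {gmax : ℕ}
    (hdeg : ∀ q : Fin n, #(univ.filter fun a => q ∈ sympSupport (g a)) ≤ gmax)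
    (hQ : 0 < Q) (hL : 0 < L) (h2 : 2 * t * Q ≤ L) {R : ℕ} (hLQ : L ≤ Q * (R + t))
    (hcube : ∀ o, IsCorrectableRegion S (cube e o R)) {E : SympVec n} (hE : E ∈ sympDual S) :
    ∃ E' ∈ sympDual S, E' - E ∈ S ∧ ∃ (m : ℕ) (γ : Fin (m + 1) → SympVec n),
      γ 0 = 0 ∧ γ (Fin.last m) = E' ∧ IsPauliWalk γ ∧
        ∀ i, energyCost g (γ i) ≤ 2 * gmax * (3 * t * Q * (3 * t * Q + (t + 1) + (t + 1)) + 3 * t * Q * (t + 1)) := by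
  -- cleaning onto the corridor network
  have hX := isCorrectableRegion_blocks (e := e) (Q := Q) (t := t) hS hg hQ hL hLQ hcube
  have hYc : (univ.filter fun q => ¬ InCorridor e Q t q)ᶜ = univ.filter fun q => InCorridor e Q t q := by
    ext q; simp
  have hclean : S ⊔ (sympDual S ⊓ supportedOn (univ.filter fun q => InCorridor e Q t q)) = sympDual S := by
    rw [← hYc]; exact sup_sympDual_inf_supportedOn_compl_eq hself hX.inf_le
  have hE' : E ∈ S ⊔ (sympDual S ⊓ supportedOn (univ.filter fun q => InCorridor e Q t q)) := by
    rw [hclean]; exact hE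
  obtain ⟨s, hs, E', ⟨hE'd, hE'Y⟩, rfl⟩ := Submodule.mem_sup.1 hE'
  refine ⟨E', hE'd, ?_, Q * (2 * L ^ 2), fun i => prefixWalk (pscKey e Q t) E' i, ?_, ?_, ?_, fun i => ?_⟩
  · have : E' - (s + E') = -s := by abel
    rw [this]; exact S.neg_mem hs
  · simp only [Fin.val_zero]; exact prefixWalk_zero
  · simp only [Fin.val_last]; exact prefixWalk_of_forall_lt (pscKey_lt hQ hL)
  · intro i
    simp only [Fin.val_castSucc, Fin.val_succ]
    exact sympWeight_prefixWalk_step (pscKey_injective hL) i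
  · have hEa : ∀ a, sympInner (g a) E' = 0 := fun a =>
      (mem_sympDual_iff.1 hE'd) (g a) (by rw [hS]; exact Submodule.subset_span ⟨a, rfl⟩)
    exact energyCost_sweep_le hQ hL h2 hg hdeg hEa hE'Y i

/-- **The plain row sweep** (the whole torus as the region): `E` itself, energy `≤ 4(t+1) g_max L`.
[cite: BravyiTerhal2009, §2 proof of Thm. 2 (row-by-row walk), used for the degenerate regimes] -/
theorem exists_walk_sweep (hS : S = Submodule.span (ZMod 2) (Set.range g))
    (hg : ∀ a, IsCubeLocalPeriodic e (t + 1) (g a)) {gmax : ℕ}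
    (hdeg : ∀ q : Fin n, #(univ.filter fun a => q ∈ sympSupport (g a)) ≤ gmax) (hL : 0 < L)
    {E : SympVec n} (hE : E ∈ sympDual S) :
    ∃ (m : ℕ) (γ : Fin (m + 1) → SympVec n), γ 0 = 0 ∧ γ (Fin.last m) = E ∧ IsPauliWalk γ ∧
      ∀ i, energyCost g (γ i) ≤ 4 * (t + 1) * gmax * L := by
  have hEa : ∀ a, sympInner (g a) E = 0 := fun a =>
    (mem_sympDual_iff.1 hE) (g a) (by rw [hS]; exact Submodule.subset_span ⟨a, rfl⟩)
  have hEs : E ∈ supportedOn (univ.filter fun q => e q 0 ∈ (univ : Finset (Fin L))) := by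
    intro i hi; exact absurd (by simp) hi
  refine ⟨L * L, rowWalk e E, rowWalk_zero E, rowWalk_last E, isPauliWalk_rowWalk hL E, fun i => ?_⟩
  calc energyCost g (rowWalk e E i) ≤ 2 * (#(univ : Finset (Fin L)) * (t + 1 + (t + 1))) * gmax :=
        energyCost_prefixWalk_le_periodic hL (by omega) hg hdeg hEa hEs i
    _ = 4 * (t + 1) * gmax * L := by rw [card_univ, Fintype.card_fin]; ring

/-- **The integer form of Theorem 4** (stabilizer codes, `L × L` torus, generators of range `t + 1`, `t ≥ 1`): every
`E ∈ S̄⊥` has a representative reached by a walk whose energy stays below some `N` with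
`N · d² ≤ C₀(t, g_max) · (L + d)²`. [cite: HaahPreskill2012, §6 Thm. 4 and its proof (pp. 13–14)] -/
theorem exists_rep_walk {k d : ℕ} (ht : 1 ≤ t) (hS : S = Submodule.span (ZMod 2) (Set.range g))
    (hg : ∀ a, IsCubeLocalPeriodic e (t + 1) (g a)) {gmax : ℕ}
    (hdeg : ∀ q : Fin n, #(univ.filter fun a => q ∈ sympSupport (g a)) ≤ gmax) (hcode : IsAdditiveCode S k d)
    (hL : 0 < L) {E : SympVec n} (hE : E ∈ sympDual S) :
    ∃ E' ∈ sympDual S, E' - E ∈ S ∧ ∃ N : ℕ, (∃ (m : ℕ) (γ : Fin (m + 1) → SympVec n),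
      γ 0 = 0 ∧ γ (Fin.last m) = E' ∧ IsPauliWalk γ ∧ ∀ i, energyCost g (γ i) ≤ N) ∧
      N * d ^ 2 ≤ (4 * (t + 1) * gmax * (49 * t ^ 2) ^ 2 + 24 * t * (t + 1) * gmax +
        2 * gmax * (18 * t ^ 2 + 9 * t) * (64 * t ^ 2 * (t + 2) ^ 2 + 4)) * (L + d) ^ 2 := by
  set K₁ := 4 * (t + 1) * gmax with hK₁
  set A := 2 * gmax * (18 * t ^ 2 + 9 * t) with hA
  set C₀ := K₁ * (49 * t ^ 2) ^ 2 + 24 * t * (t + 1) * gmax + A * (64 * t ^ 2 * (t + 2) ^ 2 + 4) with hC₀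
  have hn : n = L ^ 2 := by simpa using Fintype.card_congr e
  -- the sweep alternative, usable whenever d ≤ 49t² or L < 6t
  have sweep : d ≤ 49 * t ^ 2 ∨ L < 6 * t →
      ∃ E' ∈ sympDual S, E' - E ∈ S ∧ ∃ N : ℕ, (∃ (m : ℕ) (γ : Fin (m + 1) → SympVec n),
        γ 0 = 0 ∧ γ (Fin.last m) = E' ∧ IsPauliWalk γ ∧ ∀ i, energyCost g (γ i) ≤ N) ∧
        N * d ^ 2 ≤ C₀ * (L + d) ^ 2 := by
    intro hcase
    obtain ⟨m, γ, h0, h1, hw, he⟩ := exists_walk_sweep hS hg hdeg hL hE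
    refine ⟨E, hE, by simp, K₁ * L, ⟨m, γ, h0, h1, hw, fun i => by rw [hK₁]; exact he i⟩, ?_⟩
    have hLd : L ≤ (L + d) ^ 2 :=
      calc L ≤ L * L := Nat.le_mul_of_pos_left L hL
        _ ≤ (L + d) * (L + d) := Nat.mul_le_mul (Nat.le_add_right _ _) (Nat.le_add_right _ _)
        _ = (L + d) ^ 2 := (sq _).symm
    have hC1 : K₁ * (49 * t ^ 2) ^ 2 ≤ C₀ := by
      rw [hC₀]; exact (Nat.le_add_right _ _).trans (Nat.le_add_right _ _)
    have hC2 : 24 * t * (t + 1) * gmax ≤ C₀ := by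
      rw [hC₀]; exact (Nat.le_add_left _ _).trans (Nat.le_add_right _ _)
    rcases hcase with hd | hLt
    · calc K₁ * L * d ^ 2 ≤ K₁ * (L + d) ^ 2 * (49 * t ^ 2) ^ 2 := by
            have := Nat.pow_le_pow_left hd 2
            calc K₁ * L * d ^ 2 ≤ K₁ * (L + d) ^ 2 * d ^ 2 := by gcongr
              _ ≤ K₁ * (L + d) ^ 2 * (49 * t ^ 2) ^ 2 := by gcongr
        _ = K₁ * (49 * t ^ 2) ^ 2 * (L + d) ^ 2 := by ring
        _ ≤ C₀ * (L + d) ^ 2 := Nat.mul_le_mul_right _ hC1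
    · have hdd : d ^ 2 ≤ (L + d) ^ 2 := Nat.pow_le_pow_left (by omega) 2
      calc K₁ * L * d ^ 2 ≤ K₁ * (6 * t) * (L + d) ^ 2 := by gcongr
        _ = 24 * t * (t + 1) * gmax * (L + d) ^ 2 := by rw [hK₁]; ring
        _ ≤ C₀ * (L + d) ^ 2 := Nat.mul_le_mul_right _ hC2
  -- d ≤ 1
  rcases Nat.lt_or_ge d 2 with hd | hd
  · have : 1 ≤ t ^ 2 := Nat.one_le_pow _ _ ht
    exact sweep (Or.inl (by omega))
  -- tiny torus
  by_cases hLt : L < 6 * t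
  · exact sweep (Or.inr hLt)
  rw [not_lt] at hLt
  -- growth
  obtain ⟨R, hR1, hRL, hcube, halt⟩ := exists_correctable_cube hS hcode.1 hg hcode.2.2.1 hL ht hd
  -- the network alternative with Q periods
  have network : ∀ Q : ℕ, 0 < Q → 2 * t * Q ≤ L → L ≤ Q * (R + t) → Q * d ≤ 8 * t * (2 * L + t) ∨ Q ≤ 2 →
      ∃ E' ∈ sympDual S, E' - E ∈ S ∧ ∃ N : ℕ, (∃ (m : ℕ) (γ : Fin (m + 1) → SympVec n),
        γ 0 = 0 ∧ γ (Fin.last m) = E' ∧ IsPauliWalk γ ∧ ∀ i, energyCost g (γ i) ≤ N) ∧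
        N * d ^ 2 ≤ C₀ * (L + d) ^ 2 := by
    intro Q hQ h2 hLQ hQd
    obtain ⟨E', hE'd, hE'E, m, γ, h0, h1, hw, he⟩ :=
      exists_rep_walk_network hS hcode.1 hg hdeg hQ hL h2 hLQ hcube hE
    set N := 2 * gmax * (3 * t * Q * (3 * t * Q + (t + 1) + (t + 1)) + 3 * t * Q * (t + 1)) with hN
    refine ⟨E', hE'd, hE'E, N, ⟨m, γ, h0, h1, hw, he⟩, ?_⟩
    have hNA : N ≤ A * Q ^ 2 := by
      have h1 : 3 * t * Q * (3 * t * Q + (t + 1) + (t + 1)) ≤ Q ^ 2 * (15 * t ^ 2 + 6 * t) :=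
        calc 3 * t * Q * (3 * t * Q + (t + 1) + (t + 1))
            ≤ 3 * t * Q * (3 * t * Q + (t + 1) * Q + (t + 1) * Q) :=
              Nat.mul_le_mul_left _ (by
                have := Nat.le_mul_of_pos_right (t + 1) hQ
                omega)
          _ = Q ^ 2 * (15 * t ^ 2 + 6 * t) := by ring
      have h2' : 3 * t * Q * (t + 1) ≤ Q ^ 2 * (3 * t ^ 2 + 3 * t) :=
        calc 3 * t * Q * (t + 1) ≤ 3 * t * Q * (t + 1) * Q := Nat.le_mul_of_pos_right _ hQ
          _ = Q ^ 2 * (3 * t ^ 2 + 3 * t) := by ring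
      calc N = 2 * gmax * (3 * t * Q * (3 * t * Q + (t + 1) + (t + 1)) + 3 * t * Q * (t + 1)) := hN
        _ ≤ 2 * gmax * (Q ^ 2 * (15 * t ^ 2 + 6 * t) + Q ^ 2 * (3 * t ^ 2 + 3 * t)) :=
          Nat.mul_le_mul_left _ (Nat.add_le_add h1 h2')
        _ = A * Q ^ 2 := by rw [hA]; ring
    have hC3 : A * (64 * t ^ 2 * (t + 2) ^ 2) ≤ C₀ := by
      rw [hC₀]
      exact (Nat.mul_le_mul_left _ (Nat.le_add_right _ _)).trans (Nat.le_add_left _ _)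
    have hC4 : A * 4 ≤ C₀ := by
      rw [hC₀]
      exact (Nat.mul_le_mul_left _ (Nat.le_add_left _ _)).trans (Nat.le_add_left _ _)
    have hdd : d ^ 2 ≤ (L + d) ^ 2 := Nat.pow_le_pow_left (by omega) 2
    rcases hQd with hQd | hQ2
    · have hsq : (Q * d) ^ 2 ≤ 64 * t ^ 2 * (t + 2) ^ 2 * (L + d) ^ 2 := by
        have h3 : 2 * L + t ≤ (t + 2) * (L + d) := by
          have hexp : (t + 2) * (L + d) = t * L + t * d + 2 * L + 2 * d := by ring
          have : t ≤ t * L := Nat.le_mul_of_pos_right t hL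
          omega
        calc (Q * d) ^ 2 ≤ (8 * t * (2 * L + t)) ^ 2 := Nat.pow_le_pow_left hQd 2
          _ ≤ (8 * t * ((t + 2) * (L + d))) ^ 2 := by gcongr
          _ = 64 * t ^ 2 * (t + 2) ^ 2 * (L + d) ^ 2 := by ring
      calc N * d ^ 2 ≤ A * Q ^ 2 * d ^ 2 := Nat.mul_le_mul_right _ hNA
        _ = A * (Q * d) ^ 2 := by ring
        _ ≤ A * (64 * t ^ 2 * (t + 2) ^ 2 * (L + d) ^ 2) := Nat.mul_le_mul_left _ hsq
        _ = A * (64 * t ^ 2 * (t + 2) ^ 2) * (L + d) ^ 2 := by ring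
        _ ≤ C₀ * (L + d) ^ 2 := Nat.mul_le_mul_right _ hC3
    · calc N * d ^ 2 ≤ A * Q ^ 2 * d ^ 2 := Nat.mul_le_mul_right _ hNA
        _ ≤ A * 2 ^ 2 * (L + d) ^ 2 := by gcongr
        _ = A * 4 * (L + d) ^ 2 := by ring
        _ ≤ C₀ * (L + d) ^ 2 := Nat.mul_le_mul_right _ hC4
  rcases halt with hdR | hbig
  swap
  · -- blocks outgrow the torus: two periods
    exact network 2 (by norm_num) (by omega) (by omega) (Or.inr le_rfl)
  -- frame count reached: d ≤ 8tR (or R small)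
  by_cases hR5 : R < 5 * t
  · refine sweep (Or.inl ?_)
    have h7 : (R + 2 * t) ^ 2 ≤ (7 * t) ^ 2 := Nat.pow_le_pow_left (by omega) 2
    have h49 : (7 * t) ^ 2 = 49 * t ^ 2 := by ring
    exact ((hdR.trans (Nat.sub_le _ _)).trans h7).trans h49.le
  rw [not_lt] at hR5
  have hd8 : d ≤ 8 * t * R := by
    have h := hdR
    have : (R + 2 * t) ^ 2 - (R - 2 * t) ^ 2 = 8 * t * R := by
      have hR2 : 2 * t ≤ R := by omega
      zify [hR2, Nat.pow_le_pow_left (show R - 2 * t ≤ R + 2 * t by omega) 2]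
      ring
    omega
  set p := R + t with hp
  have hp0 : 0 < p := by omega
  set Q := (L + p - 1) / p with hQdef
  have hQ1 : 1 ≤ Q := by rw [hQdef, Nat.le_div_iff_mul_le hp0]; omega
  have hdm := Nat.div_add_mod (L + p - 1) p
  have hml := Nat.mod_lt (L + p - 1) hp0
  have hLQ : L ≤ Q * p := by
    have : p * ((L + p - 1) / p) = Q * p := by rw [hQdef]; ring
    omega
  have hQp : Q * p < L + p := by
    have : p * ((L + p - 1) / p) = Q * p := by rw [hQdef]; ring
    omega
  have hQone : L ≤ p → Q = 1 := by
    intro hpL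
    have : Q < 2 := by
      by_contra h
      rw [not_lt] at h
      have : 2 * p ≤ Q * p := Nat.mul_le_mul_right _ h
      omega
    omega
  have h2Q : 2 * t * Q ≤ L := by
    rcases Nat.lt_or_ge p L with hpL | hpL
    · have h1 : 2 * t * (L + p) ≤ L * p :=
        calc 2 * t * (L + p) ≤ 2 * t * (L + L) := Nat.mul_le_mul_left _ (by omega)
          _ = (4 * t) * L := by ring
          _ ≤ p * L := Nat.mul_le_mul_right _ (by omega)
          _ = L * p := by ring
      have h3 : 2 * t * Q * p < L * p :=
        calc 2 * t * Q * p = 2 * t * (Q * p) := by ring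
          _ < 2 * t * (L + p) := Nat.mul_lt_mul_of_pos_left hQp (by omega)
          _ ≤ L * p := h1
      exact le_of_lt (Nat.lt_of_mul_lt_mul_right h3)
    · rw [hQone hpL]; omega
  refine network Q hQ1 h2Q hLQ (Or.inl ?_)
  -- Q d ≤ Q · 8tR ≤ 8t (Q p) < 8t (L + p) ≤ 8t (2L + t)
  have h1 : Q * d ≤ 8 * t * (Q * p) := by
    calc Q * d ≤ Q * (8 * t * R) := Nat.mul_le_mul_left _ hd8
      _ ≤ Q * (8 * t * p) := by gcongr; omega
      _ = 8 * t * (Q * p) := by ring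
  have h2' : 8 * t * (Q * p) ≤ 8 * t * (L + p) := Nat.mul_le_mul_left _ hQp.le
  have h3 : p ≤ L + t := by omega
  calc Q * d ≤ 8 * t * (L + p) := h1.trans h2'
    _ ≤ 8 * t * (2 * L + t) := Nat.mul_le_mul_left _ (by omega)

/-! ### Subsystem codes with local stabilizer generators -/

/-- **The network walk for a dressed representative** (subsystem codes): with `Q` periods (`2tQ ≤ L ≤ Q(R+t)`),
every side-`R` square gauge-correctable, gauge generators `γ` and stabilizer generators `g` of range `t + 1`: every
`x ∈ S̄⊥` has `x' ≡ x (mod G)` in `S̄⊥` on the corridor network (`l_bare(blocks) = 0` and the subsystem cleaning),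
implemented by the sweep with energy `≤ 2 g_max |front|` throughout.
[cite: HaahPreskill2012, §6 proof of Thm. 4 (p. 14) with §4 proof of Thm. 1 (subsystem codes)] -/
theorem exists_rep_walk_network_subsystem {κ : Type*} {γ : κ → SympVec n} {G : Submodule (ZMod 2) (SympVec n)}
    (hG : G = Submodule.span (ZMod 2) (Set.range γ)) (hγ : ∀ b, IsCubeLocalPeriodic e (t + 1) (γ b))
    (hS : gaugeStabilizer G = Submodule.span (ZMod 2) (Set.range g))
    (hg : ∀ a, IsCubeLocalPeriodic e (t + 1) (g a)) {gmax : ℕ}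
    (hdeg : ∀ q : Fin n, #(univ.filter fun a => q ∈ sympSupport (g a)) ≤ gmax)
    (hQ : 0 < Q) (hL : 0 < L) (h2 : 2 * t * Q ≤ L) {R : ℕ} (hLQ : L ≤ Q * (R + t))
    (hcube : ∀ o, IsGaugeCorrectable G (cube e o R)) {x : SympVec n}
    (hx : x ∈ sympDual (gaugeStabilizer G)) :
    ∃ x' ∈ sympDual (gaugeStabilizer G), x' - x ∈ G ∧ ∃ (m : ℕ) (η : Fin (m + 1) → SympVec n),
      η 0 = 0 ∧ η (Fin.last m) = x' ∧ IsPauliWalk η ∧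
        ∀ i, energyCost g (η i) ≤ 2 * gmax * (3 * t * Q * (3 * t * Q + (t + 1) + (t + 1)) + 3 * t * Q * (t + 1)) := by
  have hA := SubsystemTorus.bareFree_blocks (e := e) (Q := Q) (t := t) hG hγ hQ hL hLQ hcube
  have hYc : (univ.filter fun q => ¬ InCorridor e Q t q)ᶜ = univ.filter fun q => InCorridor e Q t q := by
    ext q; simp
  have hclean : G ⊔ (sympDual (gaugeStabilizer G) ⊓ supportedOn (univ.filter fun q => InCorridor e Q t q)) =
      sympDual (gaugeStabilizer G) := by
    rw [← hYc]; exact sup_gauge_dressed_compl_eq hA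
  have hx' : x ∈ G ⊔ (sympDual (gaugeStabilizer G) ⊓ supportedOn (univ.filter fun q => InCorridor e Q t q)) := by
    rw [hclean]; exact hx
  obtain ⟨s, hs, x', ⟨hx'd, hx'Y⟩, rfl⟩ := Submodule.mem_sup.1 hx'
  refine ⟨x', hx'd, ?_, Q * (2 * L ^ 2), fun i => prefixWalk (pscKey e Q t) x' i, ?_, ?_, ?_, fun i => ?_⟩
  · have : x' - (s + x') = -s := by abel
    rw [this]; exact G.neg_mem hs
  · simp only [Fin.val_zero]; exact prefixWalk_zero
  · simp only [Fin.val_last]; exact prefixWalk_of_forall_lt (pscKey_lt hQ hL)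
  · intro i
    simp only [Fin.val_castSucc, Fin.val_succ]
    exact sympWeight_prefixWalk_step (pscKey_injective hL) i
  · have hEa : ∀ a, sympInner (g a) x' = 0 := fun a =>
      (mem_sympDual_iff.1 hx'd) (g a) (by rw [hS]; exact Submodule.subset_span ⟨a, rfl⟩)
    exact energyCost_sweep_le hQ hL h2 hg hdeg hEa hx'Y i

/-- **The integer form of Theorem 4 for subsystem codes** (`L × L` torus, gauge and stabilizer generators of range
`t + 1`, `t ≥ 1`): every `x ∈ S̄⊥` has `x' ≡ x (mod G)` reached by a walk whose energy stays below some `N` with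
`N · d² ≤ C₀(t, g_max) · (L + d)²`. [cite: HaahPreskill2012, §6 Thm. 4 and its proof (pp. 13–14)] -/
theorem exists_rep_walk_subsystem {κ : Type*} {γ : κ → SympVec n} {G : Submodule (ZMod 2) (SympVec n)} {k d : ℕ}
    (ht : 1 ≤ t) (hG : G = Submodule.span (ZMod 2) (Set.range γ)) (hγ : ∀ b, IsCubeLocalPeriodic e (t + 1) (γ b))
    (hS : gaugeStabilizer G = Submodule.span (ZMod 2) (Set.range g))
    (hg : ∀ a, IsCubeLocalPeriodic e (t + 1) (g a)) {gmax : ℕ}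
    (hdeg : ∀ q : Fin n, #(univ.filter fun a => q ∈ sympSupport (g a)) ≤ gmax) (hcode : IsSubsystemCode G k d)
    (hL : 0 < L) {x : SympVec n} (hx : x ∈ sympDual (gaugeStabilizer G)) :
    ∃ x' ∈ sympDual (gaugeStabilizer G), x' - x ∈ G ∧ ∃ N : ℕ, (∃ (m : ℕ) (η : Fin (m + 1) → SympVec n),
      η 0 = 0 ∧ η (Fin.last m) = x' ∧ IsPauliWalk η ∧ ∀ i, energyCost g (η i) ≤ N) ∧
      N * d ^ 2 ≤ (4 * (t + 1) * gmax * (49 * t ^ 2) ^ 2 + 24 * t * (t + 1) * gmax +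
        2 * gmax * (18 * t ^ 2 + 9 * t) * (64 * t ^ 2 * (t + 2) ^ 2 + 4)) * (L + d) ^ 2 := by
  set K₁ := 4 * (t + 1) * gmax with hK₁
  set A := 2 * gmax * (18 * t ^ 2 + 9 * t) with hA
  set C₀ := K₁ * (49 * t ^ 2) ^ 2 + 24 * t * (t + 1) * gmax + A * (64 * t ^ 2 * (t + 2) ^ 2 + 4) with hC₀
  -- the sweep alternative
  have sweep : d ≤ 49 * t ^ 2 ∨ L < 6 * t →
      ∃ x' ∈ sympDual (gaugeStabilizer G), x' - x ∈ G ∧ ∃ N : ℕ, (∃ (m : ℕ) (η : Fin (m + 1) → SympVec n),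
        η 0 = 0 ∧ η (Fin.last m) = x' ∧ IsPauliWalk η ∧ ∀ i, energyCost g (η i) ≤ N) ∧
        N * d ^ 2 ≤ C₀ * (L + d) ^ 2 := by
    intro hcase
    obtain ⟨m, η, h0, h1, hw, he⟩ := exists_walk_sweep hS hg hdeg hL hx
    refine ⟨x, hx, by simp, K₁ * L, ⟨m, η, h0, h1, hw, fun i => by rw [hK₁]; exact he i⟩, ?_⟩
    have hLd : L ≤ (L + d) ^ 2 :=
      calc L ≤ L * L := Nat.le_mul_of_pos_left L hL
        _ ≤ (L + d) * (L + d) := Nat.mul_le_mul (Nat.le_add_right _ _) (Nat.le_add_right _ _)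
        _ = (L + d) ^ 2 := (sq _).symm
    have hC1 : K₁ * (49 * t ^ 2) ^ 2 ≤ C₀ := by
      rw [hC₀]; exact (Nat.le_add_right _ _).trans (Nat.le_add_right _ _)
    have hC2 : 24 * t * (t + 1) * gmax ≤ C₀ := by
      rw [hC₀]; exact (Nat.le_add_left _ _).trans (Nat.le_add_right _ _)
    rcases hcase with hd | hLt
    · calc K₁ * L * d ^ 2 ≤ K₁ * (L + d) ^ 2 * (49 * t ^ 2) ^ 2 := by
            have := Nat.pow_le_pow_left hd 2
            calc K₁ * L * d ^ 2 ≤ K₁ * (L + d) ^ 2 * d ^ 2 := by gcongr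
              _ ≤ K₁ * (L + d) ^ 2 * (49 * t ^ 2) ^ 2 := by gcongr
        _ = K₁ * (49 * t ^ 2) ^ 2 * (L + d) ^ 2 := by ring
        _ ≤ C₀ * (L + d) ^ 2 := Nat.mul_le_mul_right _ hC1
    · have hdd : d ^ 2 ≤ (L + d) ^ 2 := Nat.pow_le_pow_left (by omega) 2
      calc K₁ * L * d ^ 2 ≤ K₁ * (6 * t) * (L + d) ^ 2 := by gcongr
        _ = 24 * t * (t + 1) * gmax * (L + d) ^ 2 := by rw [hK₁]; ring
        _ ≤ C₀ * (L + d) ^ 2 := Nat.mul_le_mul_right _ hC2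
  rcases Nat.lt_or_ge d 2 with hd | hd
  · have : 1 ≤ t ^ 2 := Nat.one_le_pow _ _ ht
    exact sweep (Or.inl (by omega))
  by_cases hLt : L < 6 * t
  · exact sweep (Or.inr hLt)
  rw [not_lt] at hLt
  obtain ⟨R, hR1, hRL, hcube, halt⟩ := SubsystemTorus.exists_gaugeCorrectable_cube hG hγ hcode.2 hL ht hd
  have network : ∀ Q : ℕ, 0 < Q → 2 * t * Q ≤ L → L ≤ Q * (R + t) → Q * d ≤ 8 * t * (2 * L + t) ∨ Q ≤ 2 →
      ∃ x' ∈ sympDual (gaugeStabilizer G), x' - x ∈ G ∧ ∃ N : ℕ, (∃ (m : ℕ) (η : Fin (m + 1) → SympVec n),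
        η 0 = 0 ∧ η (Fin.last m) = x' ∧ IsPauliWalk η ∧ ∀ i, energyCost g (η i) ≤ N) ∧
        N * d ^ 2 ≤ C₀ * (L + d) ^ 2 := by
    intro Q hQ h2 hLQ hQd
    obtain ⟨x', hx'd, hx'x, m, η, h0, h1, hw, he⟩ :=
      exists_rep_walk_network_subsystem hG hγ hS hg hdeg hQ hL h2 hLQ hcube hx
    set N := 2 * gmax * (3 * t * Q * (3 * t * Q + (t + 1) + (t + 1)) + 3 * t * Q * (t + 1)) with hN
    refine ⟨x', hx'd, hx'x, N, ⟨m, η, h0, h1, hw, he⟩, ?_⟩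
    have hNA : N ≤ A * Q ^ 2 := by
      have h1 : 3 * t * Q * (3 * t * Q + (t + 1) + (t + 1)) ≤ Q ^ 2 * (15 * t ^ 2 + 6 * t) :=
        calc 3 * t * Q * (3 * t * Q + (t + 1) + (t + 1))
            ≤ 3 * t * Q * (3 * t * Q + (t + 1) * Q + (t + 1) * Q) :=
              Nat.mul_le_mul_left _ (by
                have := Nat.le_mul_of_pos_right (t + 1) hQ
                omega)
          _ = Q ^ 2 * (15 * t ^ 2 + 6 * t) := by ring
      have h2' : 3 * t * Q * (t + 1) ≤ Q ^ 2 * (3 * t ^ 2 + 3 * t) :=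
        calc 3 * t * Q * (t + 1) ≤ 3 * t * Q * (t + 1) * Q := Nat.le_mul_of_pos_right _ hQ
          _ = Q ^ 2 * (3 * t ^ 2 + 3 * t) := by ring
      calc N = 2 * gmax * (3 * t * Q * (3 * t * Q + (t + 1) + (t + 1)) + 3 * t * Q * (t + 1)) := hN
        _ ≤ 2 * gmax * (Q ^ 2 * (15 * t ^ 2 + 6 * t) + Q ^ 2 * (3 * t ^ 2 + 3 * t)) :=
          Nat.mul_le_mul_left _ (Nat.add_le_add h1 h2')
        _ = A * Q ^ 2 := by rw [hA]; ring
    have hC3 : A * (64 * t ^ 2 * (t + 2) ^ 2) ≤ C₀ := by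
      rw [hC₀]
      exact (Nat.mul_le_mul_left _ (Nat.le_add_right _ _)).trans (Nat.le_add_left _ _)
    have hC4 : A * 4 ≤ C₀ := by
      rw [hC₀]
      exact (Nat.mul_le_mul_left _ (Nat.le_add_left _ _)).trans (Nat.le_add_left _ _)
    have hdd : d ^ 2 ≤ (L + d) ^ 2 := Nat.pow_le_pow_left (by omega) 2
    rcases hQd with hQd | hQ2
    · have hsq : (Q * d) ^ 2 ≤ 64 * t ^ 2 * (t + 2) ^ 2 * (L + d) ^ 2 := by
        have h3 : 2 * L + t ≤ (t + 2) * (L + d) := by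
          have hexp : (t + 2) * (L + d) = t * L + t * d + 2 * L + 2 * d := by ring
          have : t ≤ t * L := Nat.le_mul_of_pos_right t hL
          omega
        calc (Q * d) ^ 2 ≤ (8 * t * (2 * L + t)) ^ 2 := Nat.pow_le_pow_left hQd 2
          _ ≤ (8 * t * ((t + 2) * (L + d))) ^ 2 := by gcongr
          _ = 64 * t ^ 2 * (t + 2) ^ 2 * (L + d) ^ 2 := by ring
      calc N * d ^ 2 ≤ A * Q ^ 2 * d ^ 2 := Nat.mul_le_mul_right _ hNA
        _ = A * (Q * d) ^ 2 := by ring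
        _ ≤ A * (64 * t ^ 2 * (t + 2) ^ 2 * (L + d) ^ 2) := Nat.mul_le_mul_left _ hsq
        _ = A * (64 * t ^ 2 * (t + 2) ^ 2) * (L + d) ^ 2 := by ring
        _ ≤ C₀ * (L + d) ^ 2 := Nat.mul_le_mul_right _ hC3
    · calc N * d ^ 2 ≤ A * Q ^ 2 * d ^ 2 := Nat.mul_le_mul_right _ hNA
        _ ≤ A * 2 ^ 2 * (L + d) ^ 2 := by gcongr
        _ = A * 4 * (L + d) ^ 2 := by ring
        _ ≤ C₀ * (L + d) ^ 2 := Nat.mul_le_mul_right _ hC4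
  rcases halt with hdR | hbig
  swap
  · exact network 2 (by norm_num) (by omega) (by omega) (Or.inr le_rfl)
  by_cases hR5 : R < 5 * t
  · refine sweep (Or.inl ?_)
    have h7 : (R + 2 * t) ^ 2 ≤ (7 * t) ^ 2 := Nat.pow_le_pow_left (by omega) 2
    have h49 : (7 * t) ^ 2 = 49 * t ^ 2 := by ring
    exact ((hdR.trans (Nat.sub_le _ _)).trans h7).trans h49.le
  rw [not_lt] at hR5
  have hd8 : d ≤ 8 * t * R := by
    have h := hdR
    have : (R + 2 * t) ^ 2 - (R - 2 * t) ^ 2 = 8 * t * R := by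
      have hR2 : 2 * t ≤ R := by omega
      zify [hR2, Nat.pow_le_pow_left (show R - 2 * t ≤ R + 2 * t by omega) 2]
      ring
    omega
  set p := R + t with hp
  have hp0 : 0 < p := by omega
  set Q := (L + p - 1) / p with hQdef
  have hQ1 : 1 ≤ Q := by rw [hQdef, Nat.le_div_iff_mul_le hp0]; omega
  have hdm := Nat.div_add_mod (L + p - 1) p
  have hml := Nat.mod_lt (L + p - 1) hp0
  have hLQ : L ≤ Q * p := by
    have : p * ((L + p - 1) / p) = Q * p := by rw [hQdef]; ring
    omega
  have hQp : Q * p < L + p := by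
    have : p * ((L + p - 1) / p) = Q * p := by rw [hQdef]; ring
    omega
  have hQone : L ≤ p → Q = 1 := by
    intro hpL
    have : Q < 2 := by
      by_contra h
      rw [not_lt] at h
      have : 2 * p ≤ Q * p := Nat.mul_le_mul_right _ h
      omega
    omega
  have h2Q : 2 * t * Q ≤ L := by
    rcases Nat.lt_or_ge p L with hpL | hpL
    · have h1 : 2 * t * (L + p) ≤ L * p :=
        calc 2 * t * (L + p) ≤ 2 * t * (L + L) := Nat.mul_le_mul_left _ (by omega)
          _ = (4 * t) * L := by ring
          _ ≤ p * L := Nat.mul_le_mul_right _ (by omega)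
          _ = L * p := by ring
      have h3 : 2 * t * Q * p < L * p :=
        calc 2 * t * Q * p = 2 * t * (Q * p) := by ring
          _ < 2 * t * (L + p) := Nat.mul_lt_mul_of_pos_left hQp (by omega)
          _ ≤ L * p := h1
      exact le_of_lt (Nat.lt_of_mul_lt_mul_right h3)
    · rw [hQone hpL]; omega
  refine network Q hQ1 h2Q hLQ (Or.inl ?_)
  have h1 : Q * d ≤ 8 * t * (Q * p) := by
    calc Q * d ≤ Q * (8 * t * R) := Nat.mul_le_mul_left _ hd8
      _ ≤ Q * (8 * t * p) := by gcongr; omega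
      _ = 8 * t * (Q * p) := by ring
  have h2' : 8 * t * (Q * p) ≤ 8 * t * (L + p) := Nat.mul_le_mul_left _ hQp.le
  have h3 : p ≤ L + t := by omega
  calc Q * d ≤ 8 * t * (L + p) := h1.trans h2'
    _ ≤ 8 * t * (2 * L + t) := Nat.mul_le_mul_left _ (by omega)

end Assembly

end PartialSelfCorrection

open PartialSelfCorrection EnergyBarrier in
/-- **Haah–Preskill 2012, Theorem 4 — no partial self-correction in 2D — proved for stabilizer codes on the torus,
quantitatively.** «For a two-dimensional local … code … suppose that `{S_a}` is a (possibly overcomplete) set of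
geometrically local stabilizer generators, where the number of generators acting on each qubit is an `L`-independent
constant. Consider … `H = −Σ S_a`. If the code distance is `d = Ω(L)`, then the memory is not partially self
correcting — i.e., `Δ_max = O(1)`.» Typed: for every range `w` and degree `g_max` there is `c > 0` such that for every
stabilizer code `S̄ = ⟨g_a⟩` on the `L × L` torus with periodic `w × w` generator windows, at most `g_max` generators per
qubit, parameters `k` and `d ≥ 1`, EVERY `E ∈ S̄⊥` (every logical class, trivial ones included) has an equivalent
`E' ≡ E (mod S̄)` reached from the identity by a walk on the Pauli group (one qubit at a time) along which
`ε(P_i) = 2#{a : ⟨g_a, P_i⟩ = 1} ≤ c · (L/d + 1)²`; so `d ≥ δL ⇒ Δ_max ≤ c(1/δ + 1)²`, independent of `L`. Column: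
proved theorem. -- TODO(general form): the printed exponent for d = Ω(L^α) (β = 1 − α, i.e. a bound linear in L/d;
-- ours is quadratic), subsystem codes with local stabilizer generators, D ≥ 3, open boundary conditions.
[cite: HaahPreskill2012, §6 Thm. 4 (p. 13) and its proof (p. 14: «network of overlapping slabs … Arguing as in [BT09]»)] -/
theorem HaahPreskill2012_theorem4_stabilizer_torus (w gmax : ℕ) :
    ∃ c : ℝ, 0 < c ∧ ∀ (L n k d : ℕ) (e : Fin n ≃ (Fin 2 → Fin L)) (ι : Type) [Fintype ι] (g : ι → SympVec n)
      (S : Submodule (ZMod 2) (SympVec n)), S = Submodule.span (ZMod 2) (Set.range g) →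
      (∀ a, IsCubeLocalPeriodic e w (g a)) → (∀ q : Fin n, #(univ.filter fun a => q ∈ sympSupport (g a)) ≤ gmax) →
      IsAdditiveCode S k d → 1 ≤ d → ∀ E ∈ sympDual S, ∃ E' ∈ sympDual S, E' - E ∈ S ∧
        ∃ (m : ℕ) (γ : Fin (m + 1) → SympVec n), γ 0 = 0 ∧ γ (Fin.last m) = E' ∧ IsPauliWalk γ ∧
          ∀ i, (energyCost g (γ i) : ℝ) ≤ c * ((L : ℝ) / d + 1) ^ 2 := by
  obtain ⟨t, ht, hwt⟩ : ∃ t : ℕ, 1 ≤ t ∧ w ≤ t + 1 := ⟨max w 2 - 1, by omega, by omega⟩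
  set C₀ : ℕ := 4 * (t + 1) * gmax * (49 * t ^ 2) ^ 2 + 24 * t * (t + 1) * gmax +
    2 * gmax * (18 * t ^ 2 + 9 * t) * (64 * t ^ 2 * (t + 2) ^ 2 + 4) with hC₀
  refine ⟨(C₀ : ℝ) + 1, by positivity, ?_⟩
  intro L n k d e ι _ g S hS hg hdeg hcode hd1 E hE
  have hg' : ∀ a, IsCubeLocalPeriodic e (t + 1) (g a) := fun a => (hg a).mono hwt
  rcases Nat.eq_zero_or_pos L with hL0 | hL
  · -- empty lattice: everything is the identity
    subst hL0
    have hn : n = 0 := by simpa using Fintype.card_congr e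
    subst hn
    have hE0 : E = 0 := by ext i <;> exact Fin.elim0 i
    refine ⟨0, Submodule.zero_mem _, by rw [hE0, sub_zero]; exact S.zero_mem, 0, fun _ => 0, rfl, rfl,
      fun i => Fin.elim0 i, fun i => ?_⟩
    rw [PartialSelfCorrection.energyCost_zero', Nat.cast_zero]
    positivity
  obtain ⟨E', hE'd, hE'E, N, ⟨m, γ, h0, h1, hw, he⟩, hN⟩ := exists_rep_walk ht hS hg' hdeg hcode hL hE
  refine ⟨E', hE'd, hE'E, m, γ, h0, h1, hw, fun i => ?_⟩
  have hd0 : (0 : ℝ) < d := by exact_mod_cast hd1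
  have hNr : (N : ℝ) * (d : ℝ) ^ 2 ≤ (C₀ : ℝ) * ((L : ℝ) + d) ^ 2 := by exact_mod_cast hN
  have hkey : (N : ℝ) ≤ (C₀ : ℝ) * (((L : ℝ) + d) / d) ^ 2 := by
    rw [div_pow, ← mul_div_assoc, le_div_iff₀ (by positivity)]
    exact hNr
  have hfrac : ((L : ℝ) + d) / d = (L : ℝ) / d + 1 := by field_simp
  calc (energyCost g (γ i) : ℝ) ≤ N := by exact_mod_cast he i
    _ ≤ (C₀ : ℝ) * ((L : ℝ) / d + 1) ^ 2 := by rw [← hfrac]; exact hkey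
    _ ≤ ((C₀ : ℝ) + 1) * ((L : ℝ) / d + 1) ^ 2 := by gcongr; linarith

open PartialSelfCorrection EnergyBarrier in
/-- **Haah–Preskill 2012, Theorem 4 — no partial self-correction in 2D — proved in the printed generality
(subsystem codes with local gauge AND local stabilizer generators, Hamiltonian `H = −Σ_a S_a`) on the torus,
quantitatively.** For every range `w` and degree `g_max` there is `c > 0` such that for every subsystem code
`G = ⟨γ_b⟩` on the `L × L` torus (gauge generators in periodic `w × w` windows) whose stabilizer group
`S̄ = G ∩ G⊥ = ⟨g_a⟩` has generators in periodic `w × w` windows with at most `g_max` per qubit, parameters `k`,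
`d ≥ 1`: EVERY dressed logical operator `x ∈ S̄⊥` has `x' ∈ S̄⊥` in the same dressed class (`x' − x ∈ G`) reached
from the identity by a walk on the Pauli group (one qubit at a time) along which
`ε(P_i) = 2#{a : ⟨g_a, P_i⟩ = 1} ≤ c · (L/d + 1)²`; so `d ≥ δL ⇒ Δ_max ≤ c(1/δ + 1)²`, independent of `L`
(«the memory is not partially self correcting»). Column: proved theorem. -- TODO(general form): linear exponent in
-- L/d (printed β = 1 − α), D ≥ 3, open boundary conditions.
[cite: HaahPreskill2012, §6 Thm. 4 (p. 13: «Limitation on partial self correction in local subsystem codes») and its proof (p. 14)] -/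
theorem HaahPreskill2012_theorem4_torus (w gmax : ℕ) :
    ∃ c : ℝ, 0 < c ∧ ∀ (L n k d : ℕ) (e : Fin n ≃ (Fin 2 → Fin L)) (G : Submodule (ZMod 2) (SympVec n))
      (κ : Type) (γ : κ → SympVec n) (ι : Type) [Fintype ι] (g : ι → SympVec n),
      G = Submodule.span (ZMod 2) (Set.range γ) → (∀ b, IsCubeLocalPeriodic e w (γ b)) →
      gaugeStabilizer G = Submodule.span (ZMod 2) (Set.range g) → (∀ a, IsCubeLocalPeriodic e w (g a)) →
      (∀ q : Fin n, #(univ.filter fun a => q ∈ sympSupport (g a)) ≤ gmax) →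
      IsSubsystemCode G k d → 1 ≤ d → ∀ x ∈ sympDual (gaugeStabilizer G),
        ∃ x' ∈ sympDual (gaugeStabilizer G), x' - x ∈ G ∧
          ∃ (m : ℕ) (η : Fin (m + 1) → SympVec n), η 0 = 0 ∧ η (Fin.last m) = x' ∧ IsPauliWalk η ∧
            ∀ i, (energyCost g (η i) : ℝ) ≤ c * ((L : ℝ) / d + 1) ^ 2 := by
  obtain ⟨t, ht, hwt⟩ : ∃ t : ℕ, 1 ≤ t ∧ w ≤ t + 1 := ⟨max w 2 - 1, by omega, by omega⟩
  set C₀ : ℕ := 4 * (t + 1) * gmax * (49 * t ^ 2) ^ 2 + 24 * t * (t + 1) * gmax +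
    2 * gmax * (18 * t ^ 2 + 9 * t) * (64 * t ^ 2 * (t + 2) ^ 2 + 4) with hC₀
  refine ⟨(C₀ : ℝ) + 1, by positivity, ?_⟩
  intro L n k d e G κ γ ι _ g hG hγ hS hg hdeg hcode hd1 x hx
  have hγ' : ∀ b, IsCubeLocalPeriodic e (t + 1) (γ b) := fun b => (hγ b).mono hwt
  have hg' : ∀ a, IsCubeLocalPeriodic e (t + 1) (g a) := fun a => (hg a).mono hwt
  rcases Nat.eq_zero_or_pos L with hL0 | hL
  · subst hL0
    have hn : n = 0 := by simpa using Fintype.card_congr e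
    subst hn
    have hx0 : x = 0 := by ext i <;> exact Fin.elim0 i
    refine ⟨0, Submodule.zero_mem _, by rw [hx0, sub_zero]; exact G.zero_mem, 0, fun _ => 0, rfl, rfl,
      fun i => Fin.elim0 i, fun i => ?_⟩
    rw [PartialSelfCorrection.energyCost_zero', Nat.cast_zero]
    positivity
  obtain ⟨x', hx'd, hx'x, N, ⟨m, η, h0, h1, hw, he⟩, hN⟩ :=
    exists_rep_walk_subsystem ht hG hγ' hS hg' hdeg hcode hL hx
  refine ⟨x', hx'd, hx'x, m, η, h0, h1, hw, fun i => ?_⟩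
  have hd0 : (0 : ℝ) < d := by exact_mod_cast hd1
  have hNr : (N : ℝ) * (d : ℝ) ^ 2 ≤ (C₀ : ℝ) * ((L : ℝ) + d) ^ 2 := by exact_mod_cast hN
  have hkey : (N : ℝ) ≤ (C₀ : ℝ) * (((L : ℝ) + d) / d) ^ 2 := by
    rw [div_pow, ← mul_div_assoc, le_div_iff₀ (by positivity)]
    exact hNr
  have hfrac : ((L : ℝ) + d) / d = (L : ℝ) / d + 1 := by field_simp
  calc (energyCost g (η i) : ℝ) ≤ N := by exact_mod_cast he i
    _ ≤ (C₀ : ℝ) * ((L : ℝ) / d + 1) ^ 2 := by rw [← hfrac]; exact hkey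
    _ ≤ ((C₀ : ℝ) + 1) * ((L : ℝ) / d + 1) ^ 2 := by gcongr; linarith

/-! ### The sharp (linear) charging: periods adjacent to the threshold -/

namespace PartialSelfCorrection

open BPTTorus HPTradeoff EnergyBarrier

section Linear

variable {L : ℕ} (e : Fin n ≃ (Fin 2 → Fin L)) (Q t : ℕ)

/-- The sharp charging region of a threshold `i` (period `P₀ = ⌊i / 2L²⌋`): corridor columns of the periods
`P₀ − 1, P₀, P₀ + 1` × (bad rows ∪ first rows ∪ rows at the strip front), the first `t` columns × corridor rows
(the seam), and the columns at the piece front × corridor rows — `O(t² Q)` qubits. Column: definition.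
[cite: HaahPreskill2012, §6 proof of Thm. 4 (p. 14: «hence there are O(L/l) slabs») with BravyiTerhal2009 §2 proof of Thm. 2] -/
noncomputable def front₁ (i : ℕ) : Finset (Fin n) :=
  univ.filter fun q =>
    (IsCorr L Q t (e q 0 : ℕ) ∧
        (per L Q (e q 0 : ℕ) + 1 = i / (2 * L ^ 2) ∨ per L Q (e q 0 : ℕ) = i / (2 * L ^ 2) ∨
          per L Q (e q 0 : ℕ) = i / (2 * L ^ 2) + 1) ∧
        (Bad L Q t (e q 1 : ℕ) ∨ (e q 1 : ℕ) < t + 1 ∨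
          ((e q 1 : ℕ) ≤ i % (2 * L ^ 2) / L ∧ i % (2 * L ^ 2) / L ≤ (e q 1 : ℕ) + t))) ∨
      ((e q 0 : ℕ) < t ∧ IsCorr L Q t (e q 1 : ℕ)) ∨
      (IsCorr L Q t (e q 1 : ℕ) ∧ (e q 0 : ℕ) ≤ (i % (2 * L ^ 2) - L ^ 2) / L ∧
        (i % (2 * L ^ 2) - L ^ 2) / L ≤ (e q 0 : ℕ) + t)

variable {e Q t}

/-- Periods increase with the column. [cite: BravyiPoulinTerhal2010, p. 2 and Fig. 1] -/
private theorem per_mono' {x y : ℕ} (h : x ≤ y) : per L Q x ≤ per L Q y :=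
  Nat.div_le_div_right (Nat.mul_le_mul_right _ h)

/-- A column at most `t` to the right lies at most one period further (`tQ ≤ L`).
[cite: BravyiPoulinTerhal2010, p. 2 and Fig. 1] -/
private theorem per_le_per_add_one (hL : 0 < L) (h2 : 2 * t * Q ≤ L) {x y : ℕ} (h : y ≤ x + t) :
    per L Q y ≤ per L Q x + 1 := by
  refine (per_mono' h).trans ?_
  unfold per
  calc (x + t) * Q / L ≤ (x * Q + L) / L := Nat.div_le_div_right (by nlinarith)
    _ = x * Q / L + 1 := Nat.add_div_right _ hL

/-- The first `t` columns lie in period `0`. [cite: BravyiPoulinTerhal2010, p. 2 and Fig. 1] -/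
private theorem per_eq_zero_of_lt (hQ : 0 < Q) (h2 : 2 * t * Q ≤ L) {x : ℕ} (hx : x < t) : per L Q x = 0 := by
  unfold per
  apply Nat.div_eq_of_lt
  have : x * Q < t * Q := Nat.mul_lt_mul_of_pos_right hx hQ
  nlinarith

/-- Each period has at most `t` corridor columns. [cite: BravyiPoulinTerhal2010, p. 2 and Fig. 1 (region B)] -/
private theorem card_corr_per_le (hQ : 0 < Q) (hL : 0 < L) (P : ℕ) :
    #(univ.filter fun s : Fin L => IsCorr L Q t (s : ℕ) ∧ per L Q (s : ℕ) = P) ≤ t := by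
  calc #(univ.filter fun s : Fin L => IsCorr L Q t (s : ℕ) ∧ per L Q (s : ℕ) = P)
      ≤ #(Finset.Ico (pstart L Q (P + 1) - t) (pstart L Q (P + 1))) := by
        refine card_le_card_of_injOn (fun s : Fin L => (s : ℕ)) (fun s hs => ?_) (fun a _ b _ h => Fin.ext h)
        have hs' := (mem_filter.1 (mem_coe.1 hs)).2
        have hps := pstart_le_of_per_eq hQ hL hs'.2
        simp only [coe_Ico, Set.mem_Ico]
        refine ⟨?_, hps.2⟩
        -- corridor: x + t reaches the next period (or the end of the circle)
        have hPQ : P < Q := by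
          rw [← hs'.2]; unfold per
          rw [Nat.div_lt_iff_lt_mul hL, Nat.mul_comm Q L]
          exact Nat.mul_lt_mul_of_pos_right s.isLt hQ
        have hpL : pstart L Q (P + 1) ≤ L := by
          unfold pstart
          rw [Nat.div_le_iff_le_mul_add_pred hQ]
          have : (P + 1) * L ≤ Q * L := Nat.mul_le_mul_right _ hPQ
          have := hQ
          nlinarith
        rcases hs'.1 with h | h
        · omega
        · -- per (x + t) ≠ per x = P ⇒ per (x + t) ≥ P + 1 ⇒ pstart (P+1) ≤ x + t
          have hgt : P + 1 ≤ per L Q ((s : ℕ) + t) := by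
            have := per_mono' (L := L) (Q := Q) (Nat.le_add_right (s : ℕ) t)
            rw [hs'.2] at this
            omega
          unfold per at hgt
          rw [Nat.le_div_iff_mul_le hL] at hgt
          unfold pstart
          have : ((P + 1) * L + (Q - 1)) / Q ≤ (s : ℕ) + t := by
            rw [Nat.div_le_iff_le_mul_add_pred hQ]
            have := hQ
            nlinarith
          omega
    _ ≤ t := by rw [Nat.card_Ico]; omega

/-- **The sharp straddling lemma**: as `mem_front_of_straddle`, but an applied corridor-column endpoint is shown to
lie in a period adjacent to the threshold period (a window reaches at most one period further; across the seam the
block endpoint lies in the first `t` columns). [cite: HaahPreskill2012, §6 proof of Thm. 4; BravyiTerhal2009, §2 proof of Thm. 2] -/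
theorem mem_front₁_of_straddle (hQ : 0 < Q) (hL : 0 < L) (h2 : 2 * t * Q ≤ L) {c : Fin 2 → Fin L} {u v : Fin n}
    (hu : InCubePeriodic (t + 1) c (e u)) (hv : InCubePeriodic (t + 1) c (e v))
    (huY : InCorridor e Q t u) (hvY : InCorridor e Q t v) {i : ℕ} (hui : pscKey e Q t u < i)
    (hvi : i ≤ pscKey e Q t v) : u ∈ front₁ e Q t i ∨ v ∈ front₁ e Q t i := by
  have hcx := close_of_inCubePeriodic (e := e) hu hv 0
  have hcy := close_of_inCubePeriodic (e := e) hu hv 1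
  have hxu := (e u 0).isLt
  have hxv := (e v 0).isLt
  have hyu := (e u 1).isLt
  have hyv := (e v 1).isLt
  have hL2 : 0 < 2 * L ^ 2 := by positivity
  have hsq : L ^ 2 = L * L := sq L
  have hY : ∀ {q : Fin n}, InCorridor e Q t q ↔ IsCorr L Q t (e q 0 : ℕ) ∨ IsCorr L Q t (e q 1 : ℕ) := by
    intro q
    constructor
    · rintro ⟨j, hj⟩
      fin_cases j
      · exact Or.inl hj
      · exact Or.inr hj
    · rintro (h | h)
      · exact ⟨0, h⟩
      · exact ⟨1, h⟩
  have hku := key_div_mod (e := e) (Q := Q) (t := t) hL u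
  have hkv := key_div_mod (e := e) (Q := Q) (t := t) hL v
  -- periods bracket the threshold period
  have hPu : per L Q (e u 0 : ℕ) ≤ i / (2 * L ^ 2) := by rw [← hku.1]; exact Nat.div_le_div_right hui.le
  have hPv : i / (2 * L ^ 2) ≤ per L Q (e v 0 : ℕ) := by rw [← hkv.1]; exact Nat.div_le_div_right hvi
  have hns : ∀ {x : ℕ}, x < L → x < t → ¬ IsCorr L Q t x := fun hx hxt =>
    not_isCorr_of_nearStart hQ hL h2 hx (Or.inl hxt)
  by_cases hcu : IsCorr L Q t (e u 0 : ℕ) <;> by_cases hcv : IsCorr L Q t (e v 0 : ℕ)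
  · -- (corridor, corridor): same period = the threshold period; u at the strip front or near row 0
    left
    have hper := per_eq_of_close_of_isCorr hQ hL h2 hxu hxv hcu hcv hcx
    rw [if_pos hcu] at hku
    rw [if_pos hcv] at hkv
    have hP : pscKey e Q t u / (2 * L ^ 2) = pscKey e Q t v / (2 * L ^ 2) := by rw [hku.1, hkv.1, hper]
    have hdm_u := Nat.div_add_mod (pscKey e Q t u) (2 * L ^ 2)
    have hdm_v := Nat.div_add_mod (pscKey e Q t v) (2 * L ^ 2)
    have hdm_i := Nat.div_add_mod i (2 * L ^ 2)
    have hi1 : i / (2 * L ^ 2) = pscKey e Q t u / (2 * L ^ 2) := by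
      apply le_antisymm
      · rw [hP]; exact Nat.div_le_div_right hvi
      · exact Nat.div_le_div_right hui.le
    have hru : (e u 1 : ℕ) * L + (e u 0 : ℕ) < i % (2 * L ^ 2) := by
      have := hku.2; rw [hi1] at hdm_i; omega
    have hrv : i % (2 * L ^ 2) ≤ (e v 1 : ℕ) * L + (e v 0 : ℕ) := by
      have := hkv.2; rw [hi1, hP] at hdm_i; omega
    have hy0u : (e u 1 : ℕ) ≤ i % (2 * L ^ 2) / L := by
      rw [Nat.le_div_iff_mul_le hL]; nlinarith
    have hy0v : i % (2 * L ^ 2) / L ≤ (e v 1 : ℕ) := by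
      have : i % (2 * L ^ 2) < ((e v 1 : ℕ) + 1) * L := by nlinarith
      have := (Nat.div_lt_iff_lt_mul hL).2 this
      omega
    rw [front₁, mem_filter]
    refine ⟨mem_univ _, Or.inl ⟨hcu, Or.inr (Or.inl (by rw [hi1, hku.1])), ?_⟩⟩
    unfold Close at hcy
    omega
  · -- (corridor, block): v on a corridor row, u's row bad; u's period is P₀ − 1 or P₀
    have hvrow : IsCorr L Q t (e v 1 : ℕ) := ((hY).1 hvY).resolve_left hcv
    have hbad : Bad L Q t (e u 1 : ℕ) := by
      have hcy' : Close L t (e v 1 : ℕ) (e u 1 : ℕ) := by unfold Close at hcy ⊢; omega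
      exact bad_of_close_of_isCorr hQ hL h2 hyv hyu hvrow hcy'
    left
    rw [front₁, mem_filter]
    refine ⟨mem_univ _, Or.inl ⟨hcu, ?_, Or.inl hbad⟩⟩
    rcases hcx with ⟨h1, h2'⟩ | ⟨h1, h2'⟩ | h3 | h4
    · have := per_le_per_add_one (L := L) (Q := Q) hL h2 h2'
      omega
    · have := per_mono' (L := L) (Q := Q) h1
      omega
    · exact absurd hcu (hns hxu (by omega))
    · have h0 : per L Q (e v 0 : ℕ) = 0 := per_eq_zero_of_lt hQ h2 (by omega)
      omega
  · -- (block, corridor): u on a corridor row; v's row bad; v's period is P₀ or P₀ + 1, or u is at the seam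
    have hurow : IsCorr L Q t (e u 1 : ℕ) := ((hY).1 huY).resolve_left hcu
    have hbad : Bad L Q t (e v 1 : ℕ) := bad_of_close_of_isCorr hQ hL h2 hyu hyv hurow hcy
    rcases hcx with ⟨h1, h2'⟩ | ⟨h1, h2'⟩ | h3 | h4
    · right
      have := per_le_per_add_one (L := L) (Q := Q) hL h2 h2'
      rw [front₁, mem_filter]
      refine ⟨mem_univ _, Or.inl ⟨hcv, ?_, Or.inl hbad⟩⟩
      omega
    · right
      have := per_mono' (L := L) (Q := Q) h1
      rw [front₁, mem_filter]
      refine ⟨mem_univ _, Or.inl ⟨hcv, ?_, Or.inl hbad⟩⟩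
      omega
    · left
      rw [front₁, mem_filter]
      exact ⟨mem_univ _, Or.inr (Or.inl ⟨by omega, hurow⟩)⟩
    · exact absurd hcv (hns hxv (by omega))
  · -- (block, block): same period, both on corridor rows; u at the piece front
    left
    have hurow : IsCorr L Q t (e u 1 : ℕ) := ((hY).1 huY).resolve_left hcu
    have hper := per_eq_of_close_of_not_isCorr hcu hcv hcx
    rw [if_neg hcu] at hku
    rw [if_neg hcv] at hkv
    have hP : pscKey e Q t u / (2 * L ^ 2) = pscKey e Q t v / (2 * L ^ 2) := by rw [hku.1, hkv.1, hper]
    have hdm_u := Nat.div_add_mod (pscKey e Q t u) (2 * L ^ 2)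
    have hdm_v := Nat.div_add_mod (pscKey e Q t v) (2 * L ^ 2)
    have hdm_i := Nat.div_add_mod i (2 * L ^ 2)
    have hi1 : i / (2 * L ^ 2) = pscKey e Q t u / (2 * L ^ 2) := by
      apply le_antisymm
      · rw [hP]; exact Nat.div_le_div_right hvi
      · exact Nat.div_le_div_right hui.le
    have hru : L ^ 2 + ((e u 0 : ℕ) * L + (e u 1 : ℕ)) < i % (2 * L ^ 2) := by
      have := hku.2; rw [hi1] at hdm_i; omega
    have hrv : i % (2 * L ^ 2) ≤ L ^ 2 + ((e v 0 : ℕ) * L + (e v 1 : ℕ)) := by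
      have := hkv.2; rw [hi1, hP] at hdm_i; omega
    have hx0u : (e u 0 : ℕ) ≤ (i % (2 * L ^ 2) - L ^ 2) / L := by
      rw [Nat.le_div_iff_mul_le hL]
      have : (e u 0 : ℕ) * L + (e u 1 : ℕ) < i % (2 * L ^ 2) - L ^ 2 := by omega
      nlinarith
    have hx0v : (i % (2 * L ^ 2) - L ^ 2) / L ≤ (e v 0 : ℕ) := by
      have h1 : i % (2 * L ^ 2) - L ^ 2 ≤ (e v 0 : ℕ) * L + (e v 1 : ℕ) := by omega
      have h2 : i % (2 * L ^ 2) - L ^ 2 < ((e v 0 : ℕ) + 1) * L := by rw [add_one_mul]; omega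
      have := (Nat.div_lt_iff_lt_mul hL).2 h2
      omega
    have hnw1 : ¬ (L ≤ (e v 0 : ℕ) + t) := fun h => hcv (Or.inl h)
    have hnw2 : ¬ (L ≤ (e u 0 : ℕ) + t) := fun h => hcu (Or.inl h)
    rw [front₁, mem_filter]
    refine ⟨mem_univ _, Or.inr (Or.inr ⟨hurow, hx0u, ?_⟩)⟩
    unfold Close at hcx
    omega

/-- **Size of the sharp charging region**: `≤ 3t·(3tQ + 2(t+1)) + t·3tQ + (t+1)·3tQ`, linear in `Q`.
[cite: HaahPreskill2012, §6 proof of Thm. 4 («there are O(L/l) slabs»)] -/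
theorem card_front₁_le (hQ : 0 < Q) (hL : 0 < L) (h2 : 2 * t * Q ≤ L) (i : ℕ) :
    #(front₁ e Q t i) ≤ 3 * t * (3 * t * Q + (t + 1) + (t + 1)) + t * (3 * t * Q) + (t + 1) * (3 * t * Q) := by
  haveI : NeZero L := ⟨hL.ne'⟩
  set P₀ := i / (2 * L ^ 2)
  set y₀ := i % (2 * L ^ 2) / L
  set x₀ := (i % (2 * L ^ 2) - L ^ 2) / L
  set corr : Finset (Fin L) := univ.filter fun s : Fin L => IsCorr L Q t (s : ℕ) with hcorr
  have hcorr_le : #corr ≤ 3 * t * Q := by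
    refine le_trans (card_le_card fun s hs => ?_) (card_badFin_le (L := L) (t := t) hQ hL h2)
    rw [hcorr, mem_filter] at hs
    unfold badFin
    exact mem_filter.2 ⟨mem_univ _, hs.2.bad⟩
  set corr3 : Finset (Fin L) := univ.filter fun s : Fin L => IsCorr L Q t (s : ℕ) ∧
    (per L Q (s : ℕ) + 1 = P₀ ∨ per L Q (s : ℕ) = P₀ ∨ per L Q (s : ℕ) = P₀ + 1) with hcorr3
  have hcorr3_le : #corr3 ≤ 3 * t := by
    have hsub : corr3 ⊆ (univ.filter fun s : Fin L => IsCorr L Q t (s : ℕ) ∧ per L Q (s : ℕ) = P₀ - 1) ∪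
        (univ.filter fun s : Fin L => IsCorr L Q t (s : ℕ) ∧ per L Q (s : ℕ) = P₀) ∪
        (univ.filter fun s : Fin L => IsCorr L Q t (s : ℕ) ∧ per L Q (s : ℕ) = P₀ + 1) := by
      intro s hs
      rw [hcorr3, mem_filter] at hs
      simp only [mem_union, mem_filter, mem_univ, true_and]
      rcases hs.2.2 with h | h | h
      · exact Or.inl (Or.inl ⟨hs.2.1, by omega⟩)
      · exact Or.inl (Or.inr ⟨hs.2.1, h⟩)
      · exact Or.inr ⟨hs.2.1, h⟩
    calc #corr3 ≤ _ := card_le_card hsub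
      _ ≤ t + t + t := by
          refine (card_union_le _ _).trans (Nat.add_le_add ((card_union_le _ _).trans (Nat.add_le_add ?_ ?_)) ?_)
            <;> exact card_corr_per_le hQ hL _
      _ = 3 * t := by ring
  have hbad_le := card_badFin_le (L := L) (t := t) hQ hL h2
  set rows : Finset (Fin L) := badFin L Q t ∪ univ.filter (fun s : Fin L => (s : ℕ) < t + 1) ∪
    univ.filter (fun s : Fin L => (s : ℕ) ≤ y₀ ∧ y₀ ≤ (s : ℕ) + t) with hrows
  set cols : Finset (Fin L) := univ.filter (fun s : Fin L => (s : ℕ) ≤ x₀ ∧ x₀ ≤ (s : ℕ) + t) with hcols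
  set lows : Finset (Fin L) := univ.filter (fun s : Fin L => (s : ℕ) < t) with hlows
  have hIcc : ∀ (a : ℕ), #(univ.filter fun s : Fin L => (s : ℕ) ≤ a ∧ a ≤ (s : ℕ) + t) ≤ t + 1 := by
    intro a
    calc #(univ.filter fun s : Fin L => (s : ℕ) ≤ a ∧ a ≤ (s : ℕ) + t)
        ≤ #(Finset.Icc (a - t) a) := by
          refine card_le_card_of_injOn (fun s : Fin L => (s : ℕ)) (fun s hs => ?_) (fun a _ b _ h => Fin.ext h)
          have hs' := (mem_filter.1 (mem_coe.1 hs)).2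
          simp only [coe_Icc, Set.mem_Icc]; omega
      _ ≤ t + 1 := by rw [Nat.card_Icc]; omega
  have hlow : ∀ m : ℕ, #(univ.filter fun s : Fin L => (s : ℕ) < m) ≤ m := by
    intro m
    calc #(univ.filter fun s : Fin L => (s : ℕ) < m) ≤ #(Finset.range m) := by
          refine card_le_card_of_injOn (fun s : Fin L => (s : ℕ)) (fun s hs => ?_) (fun a _ b _ h => Fin.ext h)
          have hs' := (mem_filter.1 (mem_coe.1 hs)).2
          simpa using hs'
      _ = m := card_range _
  have hrows_le : #rows ≤ 3 * t * Q + (t + 1) + (t + 1) := by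
    rw [hrows]
    refine (card_union_le _ _).trans (Nat.add_le_add ((card_union_le _ _).trans
      (Nat.add_le_add hbad_le (hlow _))) ?_)
    exact hIcc _
  have hcols_le : #cols ≤ t + 1 := hIcc _
  have hlows_le : #lows ≤ t := hlow _
  calc #(front₁ e Q t i) ≤ #((corr3 ×ˢ rows ∪ lows ×ˢ corr ∪ cols ×ˢ corr).map
        ⟨fun p : Fin L × Fin L => p, fun a b h => h⟩) := by
        rw [card_map]
        refine card_le_card_of_injOn (fun q => (e q 0, e q 1)) (fun q hq => ?_) ?_
        · have hq' := (mem_filter.1 (mem_coe.1 hq)).2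
          rw [coe_union, coe_union, Set.mem_union, Set.mem_union, coe_product, coe_product, coe_product,
            Set.mem_prod, Set.mem_prod, Set.mem_prod]
          simp only [mem_coe, hcorr, hcorr3, hrows, hcols, hlows, mem_union, mem_filter, mem_univ, true_and]
          unfold badFin
          rw [mem_filter]
          rcases hq' with ⟨hc, hper, h⟩ | ⟨hx, hc⟩ | ⟨hc, h1, h2⟩
          · refine Or.inl (Or.inl ⟨⟨hc, hper⟩, ?_⟩)
            rcases h with h | h | h
            · exact Or.inl (Or.inl ⟨mem_univ _, h⟩)
            · exact Or.inl (Or.inr h)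
            · exact Or.inr h
          · exact Or.inl (Or.inr ⟨hx, hc⟩)
          · exact Or.inr ⟨⟨h1, h2⟩, hc⟩
        · intro q _ q' _ h
          simp only [Prod.mk.injEq] at h
          apply e.injective
          funext j
          fin_cases j
          · exact h.1
          · exact h.2
    _ ≤ #(corr3 ×ˢ rows) + #(lows ×ˢ corr) + #(cols ×ˢ corr) := by
        rw [card_map]
        exact (card_union_le _ _).trans (Nat.add_le_add_right (card_union_le _ _) _)
    _ ≤ 3 * t * (3 * t * Q + (t + 1) + (t + 1)) + t * (3 * t * Q) + (t + 1) * (3 * t * Q) := by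
        rw [card_product, card_product, card_product]
        exact Nat.add_le_add (Nat.add_le_add (Nat.mul_le_mul hcorr3_le hrows_le)
          (Nat.mul_le_mul hlows_le hcorr_le)) (Nat.mul_le_mul hcols_le hcorr_le)

/-- **Energy along the network sweep, sharp form**: `≤ 2 g_max · |front₁| = O(t² g_max Q)`.
[cite: HaahPreskill2012, §6 proof of Thm. 4; BravyiTerhal2009, §2 proof of Thm. 2] -/
theorem energyCost_sweep_le₁ {ι : Type*} [Fintype ι] {g : ι → SympVec n} {gmax : ℕ} (hQ : 0 < Q) (hL : 0 < L)
    (h2 : 2 * t * Q ≤ L) (hg : ∀ a, IsCubeLocalPeriodic e (t + 1) (g a))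
    (hdeg : ∀ q : Fin n, #(univ.filter fun a => q ∈ sympSupport (g a)) ≤ gmax) {E : SympVec n}
    (hE : ∀ a, sympInner (g a) E = 0) (hEs : E ∈ supportedOn (univ.filter fun q => InCorridor e Q t q)) (i : ℕ) :
    energyCost g (prefixWalk (pscKey e Q t) E i) ≤
      2 * gmax * (3 * t * (3 * t * Q + (t + 1) + (t + 1)) + t * (3 * t * Q) + (t + 1) * (3 * t * Q)) := by
  unfold energyCost
  set R := front₁ e Q t i
  have hsub : (univ.filter fun a => sympInner (g a) (prefixWalk (pscKey e Q t) E i) ≠ 0) ⊆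
      R.biUnion (fun q => univ.filter fun a => q ∈ sympSupport (g a)) := by
    intro a ha
    simp only [mem_filter, mem_univ, true_and] at ha
    obtain ⟨⟨u, hua, huE, hui⟩, ⟨v, hva, hvE, hvi⟩⟩ :=
      exists_crossing_of_sympInner_prefixWalk_ne_zero (hE a) ha
    obtain ⟨c, hc⟩ := hg a
    have hY : ∀ {q : Fin n}, q ∈ sympSupport E → InCorridor e Q t q := by
      intro q hq
      by_contra hne
      have h0 := hEs q (by simpa using hne)
      simp only [sympSupport, mem_filter, mem_univ, true_and] at hq
      rcases hq with h | h
      · exact h h0.1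
      · exact h h0.2
    rw [mem_biUnion]
    rcases mem_front₁_of_straddle hQ hL h2 (hc u hua) (hc v hva) (hY huE) (hY hvE) hui hvi with h | h
    · exact ⟨u, h, by simpa using hua⟩
    · exact ⟨v, h, by simpa using hva⟩
  calc 2 * #(univ.filter fun a => sympInner (g a) (prefixWalk (pscKey e Q t) E i) ≠ 0)
      ≤ 2 * #(R.biUnion fun q => univ.filter fun a => q ∈ sympSupport (g a)) :=
        Nat.mul_le_mul_left _ (card_le_card hsub)
    _ ≤ 2 * ∑ q ∈ R, #(univ.filter fun a => q ∈ sympSupport (g a)) :=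
        Nat.mul_le_mul_left _ card_biUnion_le
    _ ≤ 2 * ∑ _q ∈ R, gmax := Nat.mul_le_mul_left _ (sum_le_sum fun q _ => hdeg q)
    _ = 2 * (#R * gmax) := by rw [sum_const, smul_eq_mul]
    _ ≤ 2 * ((3 * t * (3 * t * Q + (t + 1) + (t + 1)) + t * (3 * t * Q) + (t + 1) * (3 * t * Q)) * gmax) := by
        gcongr; exact card_front₁_le hQ hL h2 i
    _ = 2 * gmax * (3 * t * (3 * t * Q + (t + 1) + (t + 1)) + t * (3 * t * Q) + (t + 1) * (3 * t * Q)) := by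
        ring

variable {ι : Type*} [Fintype ι] {g : ι → SympVec n}

/-- **The network walk, sharp form** (subsystem codes; the stabilizer case is `G = S̄`).
[cite: HaahPreskill2012, §6 proof of Thm. 4 (p. 14)] -/
theorem exists_rep_walk_network₁ {κ : Type*} {γ : κ → SympVec n} {G : Submodule (ZMod 2) (SympVec n)}
    (hG : G = Submodule.span (ZMod 2) (Set.range γ)) (hγ : ∀ b, IsCubeLocalPeriodic e (t + 1) (γ b))
    (hS : gaugeStabilizer G = Submodule.span (ZMod 2) (Set.range g))
    (hg : ∀ a, IsCubeLocalPeriodic e (t + 1) (g a)) {gmax : ℕ}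
    (hdeg : ∀ q : Fin n, #(univ.filter fun a => q ∈ sympSupport (g a)) ≤ gmax)
    (hQ : 0 < Q) (hL : 0 < L) (h2 : 2 * t * Q ≤ L) {R : ℕ} (hLQ : L ≤ Q * (R + t))
    (hcube : ∀ o, IsGaugeCorrectable G (cube e o R)) {x : SympVec n}
    (hx : x ∈ sympDual (gaugeStabilizer G)) :
    ∃ x' ∈ sympDual (gaugeStabilizer G), x' - x ∈ G ∧ ∃ (m : ℕ) (η : Fin (m + 1) → SympVec n),
      η 0 = 0 ∧ η (Fin.last m) = x' ∧ IsPauliWalk η ∧ ∀ i, energyCost g (η i) ≤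
        2 * gmax * (3 * t * (3 * t * Q + (t + 1) + (t + 1)) + t * (3 * t * Q) + (t + 1) * (3 * t * Q)) := by
  have hA := SubsystemTorus.bareFree_blocks (e := e) (Q := Q) (t := t) hG hγ hQ hL hLQ hcube
  have hYc : (univ.filter fun q => ¬ InCorridor e Q t q)ᶜ = univ.filter fun q => InCorridor e Q t q := by
    ext q; simp
  have hclean : G ⊔ (sympDual (gaugeStabilizer G) ⊓ supportedOn (univ.filter fun q => InCorridor e Q t q)) =
      sympDual (gaugeStabilizer G) := by
    rw [← hYc]; exact sup_gauge_dressed_compl_eq hA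
  have hx' : x ∈ G ⊔ (sympDual (gaugeStabilizer G) ⊓ supportedOn (univ.filter fun q => InCorridor e Q t q)) := by
    rw [hclean]; exact hx
  obtain ⟨s, hs, x', ⟨hx'd, hx'Y⟩, rfl⟩ := Submodule.mem_sup.1 hx'
  refine ⟨x', hx'd, ?_, Q * (2 * L ^ 2), fun i => prefixWalk (pscKey e Q t) x' i, ?_, ?_, ?_, fun i => ?_⟩
  · have : x' - (s + x') = -s := by abel
    rw [this]; exact G.neg_mem hs
  · simp only [Fin.val_zero]; exact prefixWalk_zero
  · simp only [Fin.val_last]; exact prefixWalk_of_forall_lt (pscKey_lt hQ hL)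
  · intro i
    simp only [Fin.val_castSucc, Fin.val_succ]
    exact sympWeight_prefixWalk_step (pscKey_injective hL) i
  · have hEa : ∀ a, sympInner (g a) x' = 0 := fun a =>
      (mem_sympDual_iff.1 hx'd) (g a) (by rw [hS]; exact Submodule.subset_span ⟨a, rfl⟩)
    exact energyCost_sweep_le₁ hQ hL h2 hg hdeg hEa hx'Y i

/-- **The integer form of Theorem 4, sharp**: a bound `N` with `N · d ≤ C₁(t, g_max) · (L + d)` — linear.
[cite: HaahPreskill2012, §6 Thm. 4 and its proof (pp. 13–14: «Δ_max = O(L^β), β = D − 1 − α/(D−1)»)] -/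
theorem exists_rep_walk₁ {κ : Type*} {γ : κ → SympVec n} {G : Submodule (ZMod 2) (SympVec n)} {k d : ℕ}
    (ht : 1 ≤ t) (hG : G = Submodule.span (ZMod 2) (Set.range γ)) (hγ : ∀ b, IsCubeLocalPeriodic e (t + 1) (γ b))
    (hS : gaugeStabilizer G = Submodule.span (ZMod 2) (Set.range g))
    (hg : ∀ a, IsCubeLocalPeriodic e (t + 1) (g a)) {gmax : ℕ}
    (hdeg : ∀ q : Fin n, #(univ.filter fun a => q ∈ sympSupport (g a)) ≤ gmax) (hcode : IsSubsystemCode G k d)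
    (hL : 0 < L) {x : SympVec n} (hx : x ∈ sympDual (gaugeStabilizer G)) :
    ∃ x' ∈ sympDual (gaugeStabilizer G), x' - x ∈ G ∧ ∃ N : ℕ, (∃ (m : ℕ) (η : Fin (m + 1) → SympVec n),
      η 0 = 0 ∧ η (Fin.last m) = x' ∧ IsPauliWalk η ∧ ∀ i, energyCost g (η i) ≤ N) ∧
      N * d ≤ (4 * (t + 1) * gmax * (49 * t ^ 2) + 24 * t * (t + 1) * gmax +
        2 * gmax * (21 * t ^ 2 + 9 * t) * (8 * t * (t + 2) + 2)) * (L + d) := by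
  set K₁ := 4 * (t + 1) * gmax with hK₁
  set A := 2 * gmax * (21 * t ^ 2 + 9 * t) with hA
  set C₁ := K₁ * (49 * t ^ 2) + 24 * t * (t + 1) * gmax + A * (8 * t * (t + 2) + 2) with hC₁
  -- the sweep alternative
  have sweep : d ≤ 49 * t ^ 2 ∨ L < 6 * t →
      ∃ x' ∈ sympDual (gaugeStabilizer G), x' - x ∈ G ∧ ∃ N : ℕ, (∃ (m : ℕ) (η : Fin (m + 1) → SympVec n),
        η 0 = 0 ∧ η (Fin.last m) = x' ∧ IsPauliWalk η ∧ ∀ i, energyCost g (η i) ≤ N) ∧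
        N * d ≤ C₁ * (L + d) := by
    intro hcase
    obtain ⟨m, η, h0, h1, hw, he⟩ := exists_walk_sweep hS hg hdeg hL hx
    refine ⟨x, hx, by simp, K₁ * L, ⟨m, η, h0, h1, hw, fun i => by rw [hK₁]; exact he i⟩, ?_⟩
    have hC1 : K₁ * (49 * t ^ 2) ≤ C₁ := by
      rw [hC₁]; exact (Nat.le_add_right _ _).trans (Nat.le_add_right _ _)
    have hC2 : 24 * t * (t + 1) * gmax ≤ C₁ := by
      rw [hC₁]; exact (Nat.le_add_left _ _).trans (Nat.le_add_right _ _)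
    rcases hcase with hd | hLt
    · calc K₁ * L * d ≤ K₁ * (L + d) * (49 * t ^ 2) := by gcongr; omega
        _ = K₁ * (49 * t ^ 2) * (L + d) := by ring
        _ ≤ C₁ * (L + d) := Nat.mul_le_mul_right _ hC1
    · calc K₁ * L * d ≤ K₁ * (6 * t) * (L + d) := by (gcongr; omega)
        _ = 24 * t * (t + 1) * gmax * (L + d) := by rw [hK₁]; ring
        _ ≤ C₁ * (L + d) := Nat.mul_le_mul_right _ hC2
  rcases Nat.lt_or_ge d 2 with hd | hd
  · have : 1 ≤ t ^ 2 := Nat.one_le_pow _ _ ht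
    exact sweep (Or.inl (by omega))
  by_cases hLt : L < 6 * t
  · exact sweep (Or.inr hLt)
  rw [not_lt] at hLt
  obtain ⟨R, hR1, hRL, hcube, halt⟩ := SubsystemTorus.exists_gaugeCorrectable_cube hG hγ hcode.2 hL ht hd
  have network : ∀ Q : ℕ, 0 < Q → 2 * t * Q ≤ L → L ≤ Q * (R + t) → Q * d ≤ 8 * t * (2 * L + t) ∨ Q ≤ 2 →
      ∃ x' ∈ sympDual (gaugeStabilizer G), x' - x ∈ G ∧ ∃ N : ℕ, (∃ (m : ℕ) (η : Fin (m + 1) → SympVec n),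
        η 0 = 0 ∧ η (Fin.last m) = x' ∧ IsPauliWalk η ∧ ∀ i, energyCost g (η i) ≤ N) ∧
        N * d ≤ C₁ * (L + d) := by
    intro Q hQ h2 hLQ hQd
    obtain ⟨x', hx'd, hx'x, m, η, h0, h1, hw, he⟩ :=
      exists_rep_walk_network₁ hG hγ hS hg hdeg hQ hL h2 hLQ hcube hx
    set N := 2 * gmax * (3 * t * (3 * t * Q + (t + 1) + (t + 1)) + t * (3 * t * Q) + (t + 1) * (3 * t * Q))
      with hN
    refine ⟨x', hx'd, hx'x, N, ⟨m, η, h0, h1, hw, he⟩, ?_⟩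
    have hNA : N ≤ A * Q := by
      have h1 : 3 * t * (3 * t * Q + (t + 1) + (t + 1)) ≤ Q * (9 * t ^ 2 + 6 * t ^ 2 + 6 * t) := by
        have := Nat.le_mul_of_pos_right (t + 1) hQ
        have hexp : Q * (9 * t ^ 2 + 6 * t ^ 2 + 6 * t) = 3 * t * (3 * t * Q + (t + 1) * Q + (t + 1) * Q) := by
          ring
        rw [hexp]
        exact Nat.mul_le_mul_left _ (by omega)
      have h2' : t * (3 * t * Q) + (t + 1) * (3 * t * Q) = Q * (6 * t ^ 2 + 3 * t) := by ring
      calc N = 2 * gmax * (3 * t * (3 * t * Q + (t + 1) + (t + 1)) + (t * (3 * t * Q) + (t + 1) * (3 * t * Q))) := by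
            rw [hN]; ring
        _ ≤ 2 * gmax * (Q * (9 * t ^ 2 + 6 * t ^ 2 + 6 * t) + Q * (6 * t ^ 2 + 3 * t)) := by
            rw [h2']; exact Nat.mul_le_mul_left _ (Nat.add_le_add_right h1 _)
        _ = A * Q := by rw [hA]; ring
    have hC3 : A * (8 * t * (t + 2)) ≤ C₁ := by
      rw [hC₁]
      exact (Nat.mul_le_mul_left _ (Nat.le_add_right _ _)).trans (Nat.le_add_left _ _)
    have hC4 : A * 2 ≤ C₁ := by
      rw [hC₁]
      exact (Nat.mul_le_mul_left _ (Nat.le_add_left _ _)).trans (Nat.le_add_left _ _)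
    rcases hQd with hQd | hQ2
    · have h3 : 2 * L + t ≤ (t + 2) * (L + d) := by
        have hexp : (t + 2) * (L + d) = t * L + t * d + 2 * L + 2 * d := by ring
        have : t ≤ t * L := Nat.le_mul_of_pos_right t hL
        omega
      calc N * d ≤ A * Q * d := Nat.mul_le_mul_right _ hNA
        _ = A * (Q * d) := by ring
        _ ≤ A * (8 * t * (2 * L + t)) := Nat.mul_le_mul_left _ hQd
        _ ≤ A * (8 * t * ((t + 2) * (L + d))) := by gcongr
        _ = A * (8 * t * (t + 2)) * (L + d) := by ring
        _ ≤ C₁ * (L + d) := Nat.mul_le_mul_right _ hC3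
    · calc N * d ≤ A * Q * d := Nat.mul_le_mul_right _ hNA
        _ ≤ A * 2 * (L + d) := by gcongr; omega
        _ ≤ C₁ * (L + d) := Nat.mul_le_mul_right _ hC4
  rcases halt with hdR | hbig
  swap
  · exact network 2 (by norm_num) (by omega) (by omega) (Or.inr le_rfl)
  by_cases hR5 : R < 5 * t
  · refine sweep (Or.inl ?_)
    have h7 : (R + 2 * t) ^ 2 ≤ (7 * t) ^ 2 := Nat.pow_le_pow_left (by omega) 2
    have h49 : (7 * t) ^ 2 = 49 * t ^ 2 := by ring
    exact ((hdR.trans (Nat.sub_le _ _)).trans h7).trans h49.le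
  rw [not_lt] at hR5
  have hd8 : d ≤ 8 * t * R := by
    have h := hdR
    have : (R + 2 * t) ^ 2 - (R - 2 * t) ^ 2 = 8 * t * R := by
      have hR2 : 2 * t ≤ R := by omega
      zify [hR2, Nat.pow_le_pow_left (show R - 2 * t ≤ R + 2 * t by omega) 2]
      ring
    omega
  set p := R + t with hp
  have hp0 : 0 < p := by omega
  set Q := (L + p - 1) / p with hQdef
  have hQ1 : 1 ≤ Q := by rw [hQdef, Nat.le_div_iff_mul_le hp0]; omega
  have hdm := Nat.div_add_mod (L + p - 1) p
  have hml := Nat.mod_lt (L + p - 1) hp0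
  have hLQ : L ≤ Q * p := by
    have : p * ((L + p - 1) / p) = Q * p := by rw [hQdef]; ring
    omega
  have hQp : Q * p < L + p := by
    have : p * ((L + p - 1) / p) = Q * p := by rw [hQdef]; ring
    omega
  have hQone : L ≤ p → Q = 1 := by
    intro hpL
    have : Q < 2 := by
      by_contra h
      rw [not_lt] at h
      have : 2 * p ≤ Q * p := Nat.mul_le_mul_right _ h
      omega
    omega
  have h2Q : 2 * t * Q ≤ L := by
    rcases Nat.lt_or_ge p L with hpL | hpL
    · have h1 : 2 * t * (L + p) ≤ L * p :=
        calc 2 * t * (L + p) ≤ 2 * t * (L + L) := Nat.mul_le_mul_left _ (by omega)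
          _ = (4 * t) * L := by ring
          _ ≤ p * L := Nat.mul_le_mul_right _ (by omega)
          _ = L * p := by ring
      have h3 : 2 * t * Q * p < L * p :=
        calc 2 * t * Q * p = 2 * t * (Q * p) := by ring
          _ < 2 * t * (L + p) := Nat.mul_lt_mul_of_pos_left hQp (by omega)
          _ ≤ L * p := h1
      exact le_of_lt (Nat.lt_of_mul_lt_mul_right h3)
    · rw [hQone hpL]; omega
  refine network Q hQ1 h2Q hLQ (Or.inl ?_)
  have h1 : Q * d ≤ 8 * t * (Q * p) := by
    calc Q * d ≤ Q * (8 * t * R) := Nat.mul_le_mul_left _ hd8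
      _ ≤ Q * (8 * t * p) := by gcongr; omega
      _ = 8 * t * (Q * p) := by ring
  have h2' : 8 * t * (Q * p) ≤ 8 * t * (L + p) := Nat.mul_le_mul_left _ hQp.le
  have h3 : p ≤ L + t := by omega
  calc Q * d ≤ 8 * t * (L + p) := h1.trans h2'
    _ ≤ 8 * t * (2 * L + t) := Nat.mul_le_mul_left _ (by omega)

end Linear

end PartialSelfCorrection

open PartialSelfCorrection EnergyBarrier in
/-- **Haah–Preskill 2012, Theorem 4 with the printed exponent (`D = 2`: `Δ_max = O(L/d)`, i.e. `β = 1 − α` for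
`d = Ω(L^α)`), subsystem codes with local gauge and stabilizer generators, torus — proved.** As
`HaahPreskill2012_theorem4_torus` but with the LINEAR bound `ε(P_i) ≤ c · (L/d + 1)`: «More generally, if the code
distance is `d = Ω(L^α)` in `D` spatial dimensions, then `Δ_max = O(L^β)`, where `β = D−1−α/(D−1)`» — here `D = 2`,
`β = 1 − α`. Column: proved theorem. -- TODO(general form): D ≥ 3; open boundary conditions.
[cite: HaahPreskill2012, §6 Thm. 4 (p. 13, both clauses) and its proof (p. 14: «there are O(L/l) slabs … l = O(d^{1/(D−1)})»)] -/
theorem HaahPreskill2012_theorem4_torus_linear (w gmax : ℕ) :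
    ∃ c : ℝ, 0 < c ∧ ∀ (L n k d : ℕ) (e : Fin n ≃ (Fin 2 → Fin L)) (G : Submodule (ZMod 2) (SympVec n))
      (κ : Type) (γ : κ → SympVec n) (ι : Type) [Fintype ι] (g : ι → SympVec n),
      G = Submodule.span (ZMod 2) (Set.range γ) → (∀ b, IsCubeLocalPeriodic e w (γ b)) →
      gaugeStabilizer G = Submodule.span (ZMod 2) (Set.range g) → (∀ a, IsCubeLocalPeriodic e w (g a)) →
      (∀ q : Fin n, #(univ.filter fun a => q ∈ sympSupport (g a)) ≤ gmax) →
      IsSubsystemCode G k d → 1 ≤ d → ∀ x ∈ sympDual (gaugeStabilizer G),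
        ∃ x' ∈ sympDual (gaugeStabilizer G), x' - x ∈ G ∧
          ∃ (m : ℕ) (η : Fin (m + 1) → SympVec n), η 0 = 0 ∧ η (Fin.last m) = x' ∧ IsPauliWalk η ∧
            ∀ i, (energyCost g (η i) : ℝ) ≤ c * ((L : ℝ) / d + 1) := by
  obtain ⟨t, ht, hwt⟩ : ∃ t : ℕ, 1 ≤ t ∧ w ≤ t + 1 := ⟨max w 2 - 1, by omega, by omega⟩
  set C₁ : ℕ := 4 * (t + 1) * gmax * (49 * t ^ 2) + 24 * t * (t + 1) * gmax +
    2 * gmax * (21 * t ^ 2 + 9 * t) * (8 * t * (t + 2) + 2) with hC₁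
  refine ⟨(C₁ : ℝ) + 1, by positivity, ?_⟩
  intro L n k d e G κ γ ι _ g hG hγ hS hg hdeg hcode hd1 x hx
  have hγ' : ∀ b, IsCubeLocalPeriodic e (t + 1) (γ b) := fun b => (hγ b).mono hwt
  have hg' : ∀ a, IsCubeLocalPeriodic e (t + 1) (g a) := fun a => (hg a).mono hwt
  rcases Nat.eq_zero_or_pos L with hL0 | hL
  · subst hL0
    have hn : n = 0 := by simpa using Fintype.card_congr e
    subst hn
    have hx0 : x = 0 := by ext i <;> exact Fin.elim0 i
    refine ⟨0, Submodule.zero_mem _, by rw [hx0, sub_zero]; exact G.zero_mem, 0, fun _ => 0, rfl, rfl,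
      fun i => Fin.elim0 i, fun i => ?_⟩
    rw [PartialSelfCorrection.energyCost_zero', Nat.cast_zero]
    positivity
  obtain ⟨x', hx'd, hx'x, N, ⟨m, η, h0, h1, hw, he⟩, hN⟩ :=
    exists_rep_walk₁ ht hG hγ' hS hg' hdeg hcode hL hx
  refine ⟨x', hx'd, hx'x, m, η, h0, h1, hw, fun i => ?_⟩
  have hd0 : (0 : ℝ) < d := by exact_mod_cast hd1
  have hNr : (N : ℝ) * (d : ℝ) ≤ (C₁ : ℝ) * ((L : ℝ) + d) := by exact_mod_cast hN
  have hkey : (N : ℝ) ≤ (C₁ : ℝ) * (((L : ℝ) + d) / d) := by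
    rw [← mul_div_assoc, le_div_iff₀ hd0]
    exact hNr
  have hfrac : ((L : ℝ) + d) / d = (L : ℝ) / d + 1 := by field_simp
  calc (energyCost g (η i) : ℝ) ≤ N := by exact_mod_cast he i
    _ ≤ (C₁ : ℝ) * ((L : ℝ) / d + 1) := by rw [← hfrac]; exact hkey
    _ ≤ ((C₁ : ℝ) + 1) * ((L : ℝ) / d + 1) := by gcongr; linarith

open PartialSelfCorrection EnergyBarrier in
/-- **Stabilizer special case of the sharp form** (`G = S̄`): every logical class of a 2D local stabilizer code on
the torus has an implementation with energy barrier `≤ c · (L/d + 1)`. Column: proved theorem.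
[cite: HaahPreskill2012, §6 Thm. 4 (p. 13, both clauses)] -/
theorem HaahPreskill2012_theorem4_stabilizer_torus_linear (w gmax : ℕ) :
    ∃ c : ℝ, 0 < c ∧ ∀ (L n k d : ℕ) (e : Fin n ≃ (Fin 2 → Fin L)) (ι : Type) [Fintype ι] (g : ι → SympVec n)
      (S : Submodule (ZMod 2) (SympVec n)), S = Submodule.span (ZMod 2) (Set.range g) →
      (∀ a, IsCubeLocalPeriodic e w (g a)) → (∀ q : Fin n, #(univ.filter fun a => q ∈ sympSupport (g a)) ≤ gmax) →
      IsAdditiveCode S k d → 1 ≤ d → ∀ E ∈ sympDual S, ∃ E' ∈ sympDual S, E' - E ∈ S ∧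
        ∃ (m : ℕ) (γ : Fin (m + 1) → SympVec n), γ 0 = 0 ∧ γ (Fin.last m) = E' ∧ IsPauliWalk γ ∧
          ∀ i, (energyCost g (γ i) : ℝ) ≤ c * ((L : ℝ) / d + 1) := by
  obtain ⟨c, hc, h⟩ := HaahPreskill2012_theorem4_torus_linear w gmax
  refine ⟨c, hc, ?_⟩
  intro L n k d e ι _ g S hS hg hdeg hcode hd1 E hE
  have hSS : gaugeStabilizer S = S := gaugeStabilizer_eq_self_of_isSelfOrthogonal hcode.1
  have hE' : E ∈ sympDual (gaugeStabilizer S) := by rw [hSS]; exact hE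
  obtain ⟨E', hE'd, hE'E, m, γ', h0, h1, hw, he⟩ :=
    h L n k d e S ι g ι g hS hg (hSS.trans hS) hg hdeg hcode.isSubsystemCode hd1 E hE'
  rw [hSS] at hE'd
  exact ⟨E', hE'd, hE'E, m, γ', h0, h1, hw, he⟩

end Literature.InformationTheory.QuantumCodes
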